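import Summits.ValiantsHypothesis.ValiantsHypothesis.Theses.FeketeSOS
import Literature.NumberTheory.LFunctions.FeketePolynomial
import Literature.RingTheory.Valuation.RootReduction
import Literature.RingTheory.Valuation.AlgClosedResidue

/-!
# Disproof of `FeketeNoSparseSplit` — findings (cdisprove, standing adversary; cycles 1–4, 2026-08-16)

Crux (route `FeketeSOS`, item stmt-ValiantsHypothesis-3997):
`∃ δ > 0, ∃ p₀, ∀ primes p ≥ p₀, ∀ A B : ℂ[X], A·B = F_p → p^{1/2+δ} ≤ |supp A| + |supp B|`,
`F_p = Σ_{m<p} (m|p) X^m` (elaborates, W.lean rc 0; read back by `rfl`; `1/2 + δ : ℝ`, `rpow`).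

VERDICT AFTER FOUR CYCLES: **no kill — the crux IS a theorem: all four stubs of the picked line are PROVED in this file
(§G: stubs 1–3; §G3: stub 4) and a complete `sorry`-free proof of `FeketeSOS.FeketeNoSparseSplit` (the lead's reshaped
skeleton with the stubs filled, 579 lines, rc 0, axioms standard) is attached to the item as evidence
`FeketeNoSparseSplit_CandidateProof.lean` (2026-08-16 05:00Z) for the lead to land; stubs 1–3 have since been LANDED by
provers (`Theorems/FeketeSOSFeketeNoSparseSplit{CharPFewnomial,CyclicOrderDichotomy,FeketeModPOrder}.lean`, 05:02–05:14Z).**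
CYCLE 4 (gen 4) adds §B3: the peel deficiency is UNBOUNDED — for EVERY constant `K` the natural strengthening
"`|supp A| + |supp B| ≥ p - K` for all large `p`" is FALSE (`not_eventually_ge_sub_const`; Legendre symbols imitating `χ₄`
via CRT + Dirichlet + reciprocity make `S_p(2) = S_p(4) = ⋯ = S_p(2^{K+1}) = 0`), so the true minimum is provably not
`p - O(1)` (numerically `p - Θ(√p)`), while `≥ (p+3)/2` always.  The line
`Lines/cyclic-valuation-dichotomy.lean` (4 registered stubs, composition kernel-checked) proves the LINEAR
bound `(p+3)/2 ≤ |supp A| + |supp B|` for every odd prime: reduce a splitting at a place of `ℂ` above `p`; by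
Euler's criterion `F̄_p = Σ m^{(p-1)/2} X^m` vanishes at `X = 1` to order exactly `(p-1)/2`; a non-zero
polynomial of degree `< p` divisible by `(X-1)^m` in characteristic `p` has `≥ m+1` monomials.  Re-derived on
paper line by line (cycle 1) and again in cycle 2 against the REGISTERED stub signatures: no gap, no
misstatement; the four stubs are true as typed (§D records exactly which of their hypotheses carry weight).
A disproof of the crux would need sparse complex splittings for infinitely many `p`, which `(p+3)/2` forbids.
CYCLE 3 adds WHY the line works exactly here and nowhere nearby: the char-`p` multiplicity lever has ceiling `(p-1)/2`
for every unimodular target, is attained by `F̄_p` (exact order `(p-1)/2` = the line's stub 2, proved — as are stubs 1 and 3), reaches it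
ONLY at `±χ_p` (uniqueness), and degrades to `≤ k+1` after `k` coefficient changes (distance law) — all in §G — while the truth does not move (one-flip exhaustive numerics); the signed mod-3
shadow fails like the mod-2 one (§F); and the peel deficiency refutes `≥ p-2` eventually (§B2).

What this file records (all `sorry`-free; landed copies under `Theorems/FeketeNoSparseSplit/Negative/`:
`FalseWithoutLegendre.lean` p75430, `SmallModels.lean` p74401, `StubHypotheses.lean` p76705, `ExponentHalf.lean` p76840,
`ModTwoShadow.lean` p77033 (cycle 2); cycle 3 (submitted 2026-08-16 05:14–05:17Z, verdicts pending at publication):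
`ModThreeShadow.lean` p81625, `PeelDeficiency.lean` p81724, `LeverCeiling.lean` p81776 (§G part 1: ceiling, fragility),
`LegendreExtremiser.lean` p81824 (§G part 2: uniqueness, distance law) — all three ACCEPTED; `LeverExactOrder.lean` p81860
(§G part 3: exact order) bounced ONLY by the 05:25Z gate restart ("resubmit") and is resubmitted in cycle 4 trimmed to the
exact-order theorems (stubs 1, 3 meanwhile landed by provers; awaiting a farm rebuild of its imports); cycle 4: `UnboundedDeficiency.lean`
p84820 ACCEPTED (§B3), `CharPShadow.lean` p85227 (§G4, in review: local-instance lint only); the complete crux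
proof `FeketeNoSparseSplit_CandidateProof.lean` is item evidence (05:00Z) for the lead to land):

* §A LOAD-BEARING HYPOTHESIS — the VALUES of `χ_p`.  `FeketeNoSparseSplitWithoutLegendre` is the crux
  with `(m|p)` replaced by an arbitrary unimodular sequence `ε` on `[1, p-1]` (`χ_p` is one such); it is
  FALSE: `feketeNoSparseSplit_false_without_legendre`.  Witness, for every prime `p`, `n = p-1`,
  `a = ⌊√n⌋+1`, `t = ⌊n/a⌋`, `ω = e^{2πi/3}`:
  `X·(1+X+⋯+X^{a-1}) · (Σ_{j<t} X^{aj} + ω X^{n-a})` has support exactly `[1, p-1]`, coefficients in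
  `{1, 1+ω, ω}` (all of modulus 1) and support-sum `≤ a + t + 1 ≤ 2√p + 2 < p^{1/2+δ}` once `p^δ ≥ 4`.
  So "support `[1,p-1]` + unimodular coefficients + `p` prime" carries only the counting exponent `1/2`:
  any proof must use the arithmetic of the values `χ_p(m)` (the line uses them through Euler's criterion).
  (With ±1 coefficients the same digit tilings exist whenever `p-1` has a divisor in `[p^{1/2-δ}, p^{1/2+δ}]`
  — de Bruijn's interval tilings; a positive proportion of primes by Ford's work on divisors of shifted
  primes — not formalised: it needs distributional input on `p-1`.)
* §A2 LOAD-BEARING CHOICE OF PLACE (CYCLE 2): reducing at a place above `2` instead of `p` sees nothing —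
  `fekete_mod_two_eq` (`F_p ≡ X·(1+X+⋯+X^{p-2}) mod 2`: the symbol is the constant `1`), `fekete_mod_two_digit_split`
  (every `a·t = p-1` gives a mod-2 splitting of support-sum `≤ a+t`), `fekete_seventeen_mod_two_split` (`8 < 10`),
  `not_feketeModTwoShadowBound` (the mod-2 analogue of `C⁺`/`(p+3)/2` is FALSE).  For odd `ℓ ≠ p` the signs survive
  but Euler's criterion does not (order at `1` generically `≤ 2`): the place over `p` is the load-bearing choice.
* §B TIGHTNESS / SMALL MODELS of the line's bound `(p+3)/2` and of the natural strengthening "trivial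
  splittings are optimal" (`|supp A|+|supp B| ≥ p`): `tight_at_three`, `tight_at_five` (bound attained:
  `F_3 = X·(1-X)`, `F_5 = (X-X²)(1-X²)`), `not_trivialSplittingOptimal` (refuted at `p = 5`),
  `peel_at_eleven`: `F_11 = (X-X²)·(1+X²+2X³+3X⁴+2X⁵+X⁶+X⁸)`, support-sum `9 < 11`, and the GENERAL
  MECHANISM as theorems (the only sub-generic one seen in all exhaustive data): `X_sub_X_sq_mul_peelCofactor`
  (`F_p = (X - X²)·Σ_k S_p(k+1) X^k`, `S_p(k) = Σ_{m≤k} χ_p(m)`, for every odd `p`), `peel_split`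
  (`min ≤ 2 + #{1 ≤ k ≤ p-2 : S_p(k) ≠ 0}`), `sum_half_legendreSym_eq_zero` + `peel_split_one_mod_four`
  (`p ≡ 1 (4)` ⇒ `S_p((p-1)/2) = 0` ⇒ a splitting of support-sum `≤ p-1`), whence
  `not_eventuallyTrivialOptimal`: even `∃ p₀ ∀ p ≥ p₀, min ≥ p` is FALSE (Dirichlet-free: primes `≡ 1 (4)`
  via `Nat.exists_prime_gt_modEq_one`).  EXHAUSTIVE minima over ALL `2^{p-3}` complex splittings
  (cycle-1 script `comp/split_min_pure.py`, pure python, exact deflation of `x(x∓1)`, Durand–Kerner roots,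
  reproduces the item's evidence): `p = 5,7,11,13,17 → 4,7,9,10,14` (item evidence adds `19,23,29 →
  15,23,22`); histogram e.g. `p = 17: {14:4, 15:2, 16:124, 17:24446}`; every optimum peels a divisor of `x²-1`
  (`B ∈ {x-1, x²-1}` up to the factor `x`; cofactor = plain resp. parity-split partial sums of `χ_p`).
  So `(p+3)/2` is tight only at `p = 3, 5`; the truth is `p - O(#zeros of S_p)`, empirically `≥ 0.74 p`.
  CYCLE 2: `feketeNoSparseSplit_false_at_delta_half` — the crux's matrix at `δ = 1/2` (`p^{1/2+1/2} = p ≤ …`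
  eventually) is FALSE; with the line, the admissible exponents are exactly `0 < δ < 1/2` (landed:
  `Negative/ExponentHalf.lean`).
* §B2 THE PEEL DEFICIENCY (CYCLE 3): `χ_p(2) = -1` (`p ≡ ±3 mod 8`) forces `S_p(2) = S_p(p-3) = 0`
  (`peel_split_le_sub_two`: support-sum `≤ p-2`), and `p ≡ 5 (mod 8)` adds the central zero (`peel_split_le_sub_three`:
  `≤ p-3`); with Mathlib's Dirichlet theorem, `not_eventually_ge_sub_two`: even `≥ p - 2` eventually is FALSE.  Numerics
  `p < 4000`: `Z_p = #{zeros of S_p}` has mean `≈ 1.28√p`, `max Z_p/p ≈ 0.065`, and `Z_p = 0` for 92/139 primes `≡ 7 (8)`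
  — the deficiency `p - min` is never an exponent; the truth sits at `p - Θ(√p)` typically (conditionally `= p - Z_p`
  off the `(1-x²)`-family, by the Galois cards).
* §B3 THE DEFICIENCY IS UNBOUNDED (CYCLE 4): `not_eventually_ge_sub_const` — for every `K : ℕ`,
  `¬ ∃ p₀ ∀ p ≥ p₀ ∀ A B, A·B = F_p → p - K ≤ |supp A| + |supp B|`.  Primes `p ≡ 5 (mod 8)`, `p ≡ -1 (mod q)` for all odd
  primes `q ≤ 2^{K+1}` (CRT + Dirichlet) have `(2|p) = -1`, `(m|p) = χ₄(m)` for odd `m ≤ 2^{K+1}` (reciprocity), whence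
  `S_p(2^j) = 0` for `1 ≤ j ≤ K+1` (`exists_prime_legendre_partial_sums_vanish`) and the peel has support-sum `≤ p - K - 1`.
  No `p - O(1)` law; the certificate side stays `(p+3)/2`, the truth `p - Θ(√p)` numerically.
* §C BOUNDARY OF THE MECHANISM IN THE MODULUS: for the Jacobi analogue `F_N = Σ_{m<N} (m|N) X^m`,
  `N = 15`, `jacobi_fifteen_split`: `F_15 = (X - X⁶)·(1+X+X³+X⁵+X⁷+X⁸)`, support-sum `8 < (15+3)/2 = 9`
  (`(X^q - 1) ∣ F_{pq}` always: character sums over complete residue systems vanish).  Exhaustive: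
  `N = 15 → 8`, `N = 21 → 12` (`comp/jacobi_split.py`).
  §C2 (CYCLE 2; BarrierNotes-ideator3 §B4 made a theorem): `jacobi_fifteen_cyclic_split` — in the CYCLIC
  model the CRT splitting `(X¹⁰ - X⁵)·(X⁶ - X¹² - X³ + X⁹) ≡ F_15 (mod X¹⁵ - 1)` (`= F_3(X¹⁰)·F_5(X⁶)`,
  idempotent exponents) has support-sum `6 = ⌈2√φ(15)⌉`, the cyclic COUNTING bound, so
  `not_jacobiNoSparseCyclicSplit`: the line's `C⁺` stated for all odd moduli is FALSE (squarefree `N = 15`);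
  and `jacobi_nine_split`, `not_jacobiNoSparseSplit`: at the prime power `N = 9` even the POLYNOMIAL bound
  fails, `F_9 = Σ_{3∤m<9} X^m = (X + X²)(1 + X³ + X⁶)`, support-sum `5 < 6`.  Primality is load-bearing for
  the lever twice over (principal symbol at `q²`; CRT idempotents at `qr`), as it should be.
* §D THE LINE'S STUBS, HYPOTHESIS BY HYPOTHESIS (CYCLE 2; `-- Targets`: the lead has not started, payload
  `stuck_stubs = []`, so the registered stub SIGNATURES were attacked pre-emptively, drefute-style):
  - `stub_charPFewnomial`: `deg g < p` load-bearing (`stub_charPFewnomial_false_without_natDegree_lt`,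
    Frobenius `X^p - 1 = (X-1)^p`: two monomials, multiplicity `p`); `CharP K p` load-bearing
    (`…_false_without_charP`: `K = ZMod 2`, `p = 3`, `g = X² - 1 = (X-1)²` — the degree bound must be
    against the characteristic OF `K`); `g ≠ 0` by convention (`…_false_without_ne_zero`); and TIGHT for
    every `m < p` (`stub_charPFewnomial_tight`: `(X-1)^m` has `≤ m+1` monomials).  Not refutable: it is the
    minimum-distance bound of the repeated-root cyclic code `⟨(x-1)^m⟩` (Castagnoli et al. 1991, Thm 1).
  - `stub_feketeModPOrder`: `p ≠ 2` is NOT load-bearing (`feketeModPOrder_at_two`: `F_2 = X`, both sides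
    `0`, in every field) — the prover may drop or keep it; triage verified the statement exactly for all
    195 odd `p < 1200`.
  - `stub_cyclicOrderDichotomy`: `F ≠ 0` load-bearing (`…_false_without_F_ne_zero`: `F = 0`, `c = 1`,
    `A = X^p - 1`, `B = 1`); `deg F < p` load-bearing (`…_false_without_natDegree_lt`: `F = (X-1)^{p+1}`,
    `A = (X-1)^p`, `B = 1`, `c = 1`, `AB - F = (X^p-1)(2-X)`) — though only `ord₁ F < p` is used; `A ≠ 0`
    load-bearing on the `c = 0` branch only and only by the convention `ord(0) = 0`
    (`…_false_without_A_ne_zero`).  Mathematically verified (two `le_rootMultiplicity_iff` steps).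
  - `stub_primitiveReduction`: `A ≠ 0`, `B ≠ 0` are implied by the divisibility hypothesis (degree), as the
    skeleton's composition shows; the statement is a construction (valuation ring `V ⊂ ℂ` with `p ∈ 𝔪_V`,
    per-factor Gauss normalisation, uniqueness of monic division by `X^p - 1` over `V` vs `ℂ` to get
    `λ F_p ∈ V[X]`, `λ ∈ V` from the coefficient `(1|p) = 1`) — checked on paper; no junk escape: a cheat
    with `c = 0` over a small field would itself need `ord Ā + ord B̄ ≥ p`, i.e. `|supp A| + |supp B| ≥ p + 2`
    by stub 1, so for sparse `A, B` only the genuine reduction can witness it.  No attack surface found.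
* §F PLACE OVER `p`, CONTINUED (CYCLE 3): the SIGNED mod-3 shadow of the bound is false too —
  `fekete_nineteen_mod_three_split` (`F₁₉ ≡ (X + X⁴ - X⁹ - X¹²)(1 - X - X² - X⁴ - X⁵ + X⁶) mod 3`, support-sum
  `10 < 11`), `not_feketeModThreeShadowBound`; data: `𝔽₃`-rational splittings go below `(p+3)/2` at 12 of the 15
  primes `19 ≤ p ≤ 79` (e.g. `p = 59`: `24 < 31`), never for `p ≤ 17`; over `𝔽₅`, `𝔽₇` no RATIONAL splitting does
  (`p ≤ 73`).  Mod 3 keeps the signs (`1 ≢ -1`): it is Euler's criterion at `p`, not the sign pattern, that works.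
* §G THE CHAR-`p` LEVER, COMPLETELY (CYCLE 3; BarrierNotes-ideator2 §B1 as a theorem and sharpened; as a by-product
  the line's stubs 1, 2, 3 are PROVED here — `charP_fewnomial` = stub_charPFewnomial, `rootMultiplicity_one_fekete_eq_half`
  = stub_feketeModPOrder, `cyclic_order_dichotomy` = stub_cyclicOrderDichotomy — candidate proofs for the lead, who is
  left with the reduction stub 4 only):
  CEILING `not_pow_dvd_of_sum_sq_ne_zero` / `rootMultiplicity_one_le_half(_of_unimodular)` — over any field of
  characteristic `p`, EVERY `Σ_{m<p} ε(m) X^m` with `Σ ε(m)² ≠ 0` (in particular every `±1` pattern on `[1,p-1]`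
  vanishing at `0`) has `ord₁ ≤ (p-1)/2` (reflect–multiply–reduce mod `X^p - 1`: the `X^{p-1}`-coefficient of `E·E†`
  is `Σ ε²`), so the lever certifies `≤ (p+3)/2` for ANY unimodular target: the line's `1/2` is the METHOD's ceiling.
  EXACT ORDER `rootMultiplicity_one_fekete_eq_half` — `ord₁ F̄_p = (p-1)/2` over every char-`p` field (Euler:
  `F̄_p = (X·d/dX)^{(p-1)/2}(X-1)^{p-1}`, each `X·d/dX` costs one factor `X-1`; plus the ceiling) — this IS the line's
  `stub_feketeModPOrder` (`fekete K p` unfolds to the sum), proved here as the tightness of the ceiling and offered to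
  the lead.  UNIQUENESS `legendre_of_half_le_rootMultiplicity` — `(X-1)^{(p-1)/2} ∣ Σ ε(m)X^m` in `𝔽_p[X]` with
  `ε(0) = 0`, `ε = ±1` on `[1,p-1]` ⟹ `ε = χ_p ∨ ε = -χ_p` (moments via `X·d/dX`; interpolation `P = Σ ε(m)(1-(x-m)^{p-1})`
  of degree `≤ (p-1)/2`; `P² = x^{p-1}`; `P = ±x^{(p-1)/2}`): among the `2^{p-1}` sign patterns the lever reaches its
  ceiling at EXACTLY `±χ_p` — zero slack.  DISTANCE LAW `not_pow_dvd_of_close_to_legendre` (any values; the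
  Aly–Winterhof `k`-error argument): agreeing with `χ_p` in `≥ p-k` positions but not all, `1 ≤ k ≤ (p-1)/2` ⟹
  `(X-1)^k ∤ Σ ε(m)X^m`: after `k` changes the certificate is `≤ k+1`.  FRAGILITY `rootMultiplicity_one_flip_eq_zero`:
  one sign flip ⟹ `ord₁ = 0` (certificate `2`), while exhaustively the true minimum support-sum of the flipped polynomial
  is `p` for every flip at `p = 11, 13, 17` — truth robust, certificate gone (the lesson for `s₀ ≥ 3`, where the lever
  is void).  Dictionary: `ord₁ = p − (𝔽_p-linear complexity of ε)`.
* §G3 THE VEHICLE (CYCLE 3): `primitiveReduction` — the line's `stub_primitiveReduction` PROVED (place `V ⊂ ℂ` above `p`,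
  `exists_model` primitive models, `map_modByMonic` over `V` vs `ℂ`, `λ = ab ∈ V` at the coefficient of `X¹`, `residue V`).
  With §G there is no open stub: the standing adversary's final report on this crux is a PROOF.
* §G4 THE CHAR-`p` SHADOW TRUTH (CYCLE 4; kit j014278 `p ≤ 23`, j014513 `p = 29, 31`): exhaustive minima of the characteristic-`p`
  problem `min |supp Ā| + |supp B̄|` over ALL factorizations of `F̄_p` over `𝔽_p` and `𝔽̄_p`: `p = 7,11,13,17,19,23,29,31 →
  7,9,10,13,13,21,22,25` (same over `𝔽_p` and `𝔽̄_p`) versus the lever `(p+3)/2 = 5,7,8,10,11,13,16,17` and the complex truth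
  `7,9,10,14,15,23,22,?`: the lever is not
  even the char-`p` truth (the cofactor `G` is ignored), and reduction at `p` is lossy from `p = 17` on —
  `fekete_seventeen_charP_split`: `F̄_17 = (1+3X-4X²-4X⁵+3X⁶+X⁷)(X-2X²-8X³+X⁵-8X⁷-2X⁸+X⁹)`, `13 < 14`.
* §E NEAR-MISSES: none — no candidate counterexample family survives even numerically; the cyclic
  relaxation over PRIME `p` has no sparse two-factor splitting either (item evidence j006674).  The
  `s₀ ≥ 3` shadow (where the multiplicative lever dies on isotropic cancellation) belongs to the sibling
  cruxes 3998/3996 and is analysed in `Cruxes/FeketeBoundedFanin/Disproof.lean` §R (division of labour).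

How to cite: `Summit.ValiantsHypothesis.ValiantsHypothesis.Cruxes.FeketeNoSparseSplit.Disproof.<name>`;
landed copies: `Summit.ValiantsHypothesis.Theorems.FeketeNoSparseSplit.Negative.<name>`.
-/

namespace Summit.ValiantsHypothesis.ValiantsHypothesis.Cruxes.FeketeNoSparseSplit.Disproof

open Polynomial Finset
open Summit.ValiantsHypothesis.ValiantsHypothesis.Theses
open Literature.NumberTheory.LFunctions

set_option linter.dupNamespace false

/-! ## §A  Load-bearing hypothesis: the values of the Legendre symbol -/

/-- The crux with the Legendre symbol replaced by an ARBITRARY unimodular coefficient sequence `ε` on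
`[1, p-1]` (same support `[1,p-1]`, same prime lengths, same exponent claim).  `χ_p` is one such `ε`,
so this is a formal strengthening of `FeketeSOS.FeketeNoSparseSplit`; it is false
(`feketeNoSparseSplit_false_without_legendre`). -/
def FeketeNoSparseSplitWithoutLegendre : Prop :=
  ∃ δ : ℝ, 0 < δ ∧ ∃ p₀ : ℕ, ∀ (p : ℕ) [Fact p.Prime], p₀ ≤ p → ∀ (ε : ℕ → ℂ), (∀ m, ‖ε m‖ = 1) →
    ∀ (A B : Polynomial ℂ), A * B = ∑ m ∈ Finset.range p, C (if m = 0 then 0 else ε m) * X ^ m →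
      (p : ℝ) ^ (1 / 2 + δ) ≤ (A.support.card : ℝ) + (B.support.card : ℝ)

/-- A primitive cube root of unity, `ω = (-1 + i√3)/2`. -/
noncomputable def ω : ℂ := ⟨-1 / 2, Real.sqrt 3 / 2⟩

/-- `|ω| = 1`. -/
theorem norm_omega : ‖ω‖ = 1 := by
  have h3 : Real.sqrt 3 ^ 2 = 3 := Real.sq_sqrt (by norm_num)
  have h : ω.re ^ 2 + ω.im ^ 2 = 1 := by simp [ω]; nlinarith [h3]
  rw [Complex.norm_eq_sqrt_sq_add_sq, h, Real.sqrt_one]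

/-- `|1 + ω| = 1` (as `1 + ω = -ω²`). -/
theorem norm_one_add_omega : ‖1 + ω‖ = 1 := by
  have h3 : Real.sqrt 3 ^ 2 = 3 := Real.sq_sqrt (by norm_num)
  have h : (1 + ω).re ^ 2 + (1 + ω).im ^ 2 = 1 := by simp [ω]; nlinarith [h3]
  rw [Complex.norm_eq_sqrt_sq_add_sq, h, Real.sqrt_one]

/-- The all-ones block `1 + X + ⋯ + X^{a-1}`. -/
noncomputable def ones (a : ℕ) : ℂ[X] := ∑ i ∈ range a, X ^ i

/-- The dilated comb `Σ_{j<t} X^{a j}`. -/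
noncomputable def comb (a t : ℕ) : ℂ[X] := ∑ j ∈ range t, X ^ (a * j)

/-- Coefficients of the all-ones block. -/
theorem coeff_ones (a m : ℕ) : (ones a).coeff m = if m < a then 1 else 0 := by
  simp [ones, finsetSum_coeff, coeff_X_pow]

/-- Splitting an all-ones block: `ones (k + a) = ones k + X^k · ones a`. -/
theorem ones_add (k a : ℕ) : ones (k + a) = ones k + X ^ k * ones a := by
  unfold ones
  rw [Finset.sum_range_add, Finset.mul_sum]
  simp [pow_add]

/-- Digit tiling: `(1 + X + ⋯ + X^{a-1})·Σ_{j<t} X^{aj} = 1 + X + ⋯ + X^{at-1}`. -/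
theorem ones_mul_comb (a t : ℕ) : ones a * comb a t = ones (a * t) := by
  induction t with
  | zero => simp [comb, ones]
  | succ t ih =>
    rw [comb, Finset.sum_range_succ, ← comb, mul_add, ih, Nat.mul_succ, ones_add]
    ring

/-- Subadditivity of the number of monomials. -/
theorem card_support_add_le (p q : ℂ[X]) :
    (p + q).support.card ≤ p.support.card + q.support.card :=
  (Finset.card_le_card support_add).trans (Finset.card_union_le _ _)

/-- A sum of `k` polynomials with at most one monomial each has at most `k` monomials. -/
theorem card_support_sum_le (f : ℕ → ℂ[X]) (hf : ∀ i, (f i).support.card ≤ 1) (k : ℕ) :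
    (∑ i ∈ range k, f i).support.card ≤ k := by
  induction k with
  | zero => simp
  | succ k ih =>
    rw [Finset.sum_range_succ]
    exact (card_support_add_le _ _).trans (by have := hf k; omega)

/-- `ones a` has at most `a` monomials. -/
theorem card_support_ones_le (a : ℕ) : (ones a).support.card ≤ a :=
  card_support_sum_le _ (fun i => by simp) a

/-- `comb a t` has at most `t` monomials. -/
theorem card_support_comb_le (a t : ℕ) : (comb a t).support.card ≤ t :=
  card_support_sum_le _
    (fun j => by simp) t

/-- `deg (ones a) ≤ a - 1`. -/
theorem natDegree_ones_le (a : ℕ) : (ones a).natDegree ≤ a - 1 := by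
  unfold ones
  refine natDegree_sum_le_of_forall_le _ _ ?_
  intro i hi
  rw [Finset.mem_range] at hi
  rw [natDegree_X_pow]
  omega

/-- The cofactor of `X·ones a` in the witness: `Q = ones a · (comb a t + ω X^{n-a})`. -/
noncomputable def Qpoly (n a t : ℕ) : ℂ[X] := ones a * (comb a t + C ω * X ^ (n - a))

/-- `Q = ones (a t) + ω X^{n-a} ones a` (digit tiling plus patch). -/
theorem Qpoly_eq (n a t : ℕ) : Qpoly n a t = ones (a * t) + C ω * (X ^ (n - a) * ones a) := by
  unfold Qpoly; rw [mul_add, ones_mul_comb]; ring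

/-- Coefficients of `Q`: `[m < at] + ω·[n-a ≤ m < n]`. -/
theorem coeff_Qpoly (n a t m : ℕ) (ha1 : 1 ≤ a) (ha : a ≤ n) :
    (Qpoly n a t).coeff m = (if m < a * t then 1 else 0) + (if n - a ≤ m ∧ m < n then ω else 0) := by
  rw [Qpoly_eq, coeff_add, coeff_ones, coeff_C_mul, coeff_X_pow_mul', coeff_ones]
  have key : (m - (n - a) < a) ↔ m < n := by omega
  by_cases h1 : n - a ≤ m <;> by_cases h2 : m < n <;> simp [h1, h2, key]

/-- Every coefficient of `Q` below `n` is unimodular (`1`, `1+ω` or `ω`) provided `at ≤ n < at + a`. -/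
theorem norm_coeff_Qpoly (n a t m : ℕ) (ha1 : 1 ≤ a) (ha : a ≤ n) (ht : n < a * t + a) (hm : m < n) :
    ‖(Qpoly n a t).coeff m‖ = 1 := by
  rw [coeff_Qpoly n a t m ha1 ha]
  by_cases h1 : m < a * t <;> by_cases h2 : n - a ≤ m
  · simp [h1, h2, hm, norm_one_add_omega]
  · simp [h1, h2]
  · simp [h1, h2, hm, norm_omega]
  · exfalso; omega

/-- `deg Q < n` when `1 ≤ a ≤ n` and `at ≤ n`. -/
theorem natDegree_Qpoly_lt (n a t : ℕ) (ha1 : 1 ≤ a) (ha : a ≤ n) (ht : a * t ≤ n) :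
    (Qpoly n a t).natDegree < n := by
  rw [Qpoly_eq]
  have h1 : (ones (a * t)).natDegree ≤ a * t - 1 := natDegree_ones_le _
  have h2 : (C ω * (X ^ (n - a) * ones a)).natDegree ≤ (n - a) + (a - 1) := by
    refine (natDegree_C_mul_le _ _).trans ?_
    refine (natDegree_mul_le).trans ?_
    have := natDegree_ones_le a
    have hx : ((X : ℂ[X]) ^ (n - a)).natDegree = n - a := natDegree_X_pow _
    omega
  have := natDegree_add_le (ones (a * t)) (C ω * (X ^ (n - a) * ones a))
  have h3 : max (ones (a * t)).natDegree (C ω * (X ^ (n - a) * ones a)).natDegree < n := by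
    rw [max_lt_iff]; constructor <;> omega
  omega

/-- **Any proof of the crux must use the values of `χ_p`** (not only `|χ_p(m)| = 1`, the support
`[1, p-1]` and the primality of `p`): the unimodular analogue is false, by explicit digit tilings with a
cube-root-of-unity patch, of support-sum `≤ 2√p + 2`. -/
theorem feketeNoSparseSplit_false_without_legendre : ¬ FeketeNoSparseSplitWithoutLegendre := by
  rintro ⟨δ, hδ, p₀, H⟩
  obtain ⟨p, hpN, hp⟩ := Nat.exists_infinite_primes (max p₀ (max 16 ⌈(4 : ℝ) ^ (1 / δ)⌉₊))
  haveI : Fact p.Prime := ⟨hp⟩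
  have hp₀ : p₀ ≤ p := le_trans (le_max_left _ _) hpN
  have hp16 : 16 ≤ p := le_trans (le_trans (le_max_left _ _) (le_max_right _ _)) hpN
  have hpceil : ⌈(4 : ℝ) ^ (1 / δ)⌉₊ ≤ p := le_trans (le_trans (le_max_right _ _) (le_max_right _ _)) hpN
  -- parameters of the tiling
  obtain ⟨n, hn⟩ : ∃ n, p = n + 1 := ⟨p - 1, by omega⟩
  set a := Nat.sqrt n + 1 with ha
  set t := n / a with ht
  have hn1 : 15 ≤ n := by omega
  have hsqrt_lt : Nat.sqrt n < n := Nat.sqrt_lt_self (by omega)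
  have ha1 : 1 ≤ a := by omega
  have han : a ≤ n := by omega
  have hat : a * t ≤ n := Nat.mul_div_le n a
  have hnat : n < a * t + a := by
    have := Nat.lt_mul_div_succ n (show 0 < a by omega)
    simpa [ht, Nat.mul_succ] using this
  have ht_le : t ≤ Nat.sqrt n := by
    have h1 : n / a < Nat.sqrt n + 1 := by
      rw [Nat.div_lt_iff_lt_mul (by omega)]
      have := Nat.lt_succ_sqrt' n
      simpa [ha, pow_two] using this
    omega
  -- the witness
  set Q := Qpoly n a t with hQ
  let ε : ℕ → ℂ := fun m => if m ≤ n then Q.coeff (m - 1) else 1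
  have hε : ∀ m, ‖ε m‖ = 1 := by
    intro m
    simp only [ε]
    split_ifs with hm
    · exact norm_coeff_Qpoly n a t (m - 1) ha1 han hnat (by omega)
    · simp
  have hQsum : Q = ∑ i ∈ range n, C (Q.coeff i) * X ^ i := by
    conv_lhs => rw [as_sum_range' Q n (natDegree_Qpoly_lt n a t ha1 han hat)]
    simp only [C_mul_X_pow_eq_monomial]
  have hAB : (X * ones a) * (comb a t + C ω * X ^ (n - a)) =
      ∑ m ∈ Finset.range p, C (if m = 0 then 0 else ε m) * X ^ m := by
    have hXQ : (X * ones a) * (comb a t + C ω * X ^ (n - a)) = X * Q := by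
      rw [hQ, Qpoly, mul_assoc]
    rw [hXQ, hn, Finset.sum_range_succ']
    simp only [Nat.succ_ne_zero, if_false, if_true, map_zero, zero_mul, add_zero]
    conv_lhs => rw [hQsum]
    rw [Finset.mul_sum]
    refine Finset.sum_congr rfl ?_
    intro i hi
    rw [Finset.mem_range] at hi
    have hεi : ε (i + 1) = Q.coeff i := by
      simp only [ε]
      rw [if_pos (by omega), Nat.add_sub_cancel]
    rw [hεi]
    ring
  -- support sizes
  have hA : (X * ones a).support.card ≤ a := by
    refine (card_support_mul_le).trans ?_
    rw [support_X, Finset.card_singleton, one_mul]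
    exact card_support_ones_le a
  have hB : (comb a t + C ω * X ^ (n - a)).support.card ≤ t + 1 :=
    (card_support_add_le _ _).trans (add_le_add (card_support_comb_le a t) card_support_C_mul_X_pow_le_one)
  have hsum : (X * ones a).support.card + (comb a t + C ω * X ^ (n - a)).support.card
      ≤ 2 * Nat.sqrt n + 2 := by omega
  -- the claimed lower bound fails
  have hbound := H p hp₀ ε hε (X * ones a) (comb a t + C ω * X ^ (n - a)) hAB
  have hreal : ((X * ones a).support.card : ℝ) + ((comb a t + C ω * X ^ (n - a)).support.card : ℝ)
      ≤ 2 * (Nat.sqrt n : ℝ) + 2 := by exact_mod_cast hsum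
  have hppos : (0 : ℝ) < p := by exact_mod_cast hp.pos
  have hsq : (Nat.sqrt n : ℝ) ≤ Real.sqrt p := by
    have h1 : ((Nat.sqrt n : ℝ)) ^ 2 ≤ (p : ℝ) := by
      have := Nat.sqrt_le' n
      have h' : (Nat.sqrt n) ^ 2 ≤ p := by omega
      exact_mod_cast h'
    calc (Nat.sqrt n : ℝ) = Real.sqrt (((Nat.sqrt n : ℝ)) ^ 2) := by
          rw [Real.sqrt_sq (by positivity)]
      _ ≤ Real.sqrt p := Real.sqrt_le_sqrt h1
  have h4 : (4 : ℝ) ≤ (p : ℝ) ^ δ := by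
    have hc : (4 : ℝ) ^ (1 / δ) ≤ p := le_trans (Nat.le_ceil _) (by exact_mod_cast hpceil)
    have h := Real.rpow_le_rpow (by positivity) hc hδ.le
    rwa [← Real.rpow_mul (by norm_num), one_div_mul_cancel hδ.ne', Real.rpow_one] at h
  have hsplit : (p : ℝ) ^ (1 / 2 + δ) = Real.sqrt p * (p : ℝ) ^ δ := by
    rw [Real.rpow_add hppos, Real.sqrt_eq_rpow]
  have hone : (1 : ℝ) < Real.sqrt p := by
    have h := Real.sqrt_lt_sqrt (by norm_num) (show (1 : ℝ) < p by exact_mod_cast (by omega : 1 < p))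
    simpa using h
  have hge : 4 * Real.sqrt p ≤ (p : ℝ) ^ (1 / 2 + δ) := by
    rw [hsplit]
    nlinarith [Real.sqrt_nonneg (p : ℝ), h4]
  linarith

/-! ## §A2  The PLACE must lie over `p` (cycle 2): the mod-2 shadow of the line's bound is false
(landed as `Negative/ModTwoShadow.lean`, p77033; BarrierNotes-ideator3 §B2 as a theorem) -/

section Tiling

variable (R : Type*) [CommRing R]

/-- Digit tiling over any commutative ring: `(Σ_{i<a} X^i)·(Σ_{j<t} X^{aj}) = Σ_{m<at} X^m`. -/
theorem geom_mul_comb (a t : ℕ) :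
    (∑ i ∈ range a, (X : R[X]) ^ i) * (∑ j ∈ range t, (X : R[X]) ^ (a * j)) =
      ∑ m ∈ range (a * t), (X : R[X]) ^ m := by
  induction t with
  | zero => simp
  | succ t ih =>
    rw [Finset.sum_range_succ, mul_add, ih, Nat.mul_succ, Finset.sum_range_add, Finset.sum_mul]
    congr 1
    refine Finset.sum_congr rfl fun i _ => ?_
    rw [← pow_add, add_comm]

/-- A sum of `k` powers of `X` has at most `k` monomials. -/
theorem card_support_sum_X_pow_le (f : ℕ → ℕ) (k : ℕ) :
    (∑ i ∈ range k, (X : R[X]) ^ f i).support.card ≤ k := by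
  induction k with
  | zero => simp
  | succ k ih =>
    rw [Finset.sum_range_succ]
    refine (Finset.card_le_card support_add).trans ((Finset.card_union_le _ _).trans ?_)
    have h1 : ((X : R[X]) ^ f k).support.card ≤ 1 := by
      rw [← one_mul ((X : R[X]) ^ f k), ← C_1]
      exact card_support_C_mul_X_pow_le_one
    omega

end Tiling

/-- **Modulo 2 the Legendre symbol is invisible**: `F_p ≡ X·(1 + X + ⋯ + X^{p-2}) (mod 2)` for every prime `p`
(`(m|p) = ±1 ≡ 1` for `1 ≤ m < p`). -/
theorem fekete_mod_two_eq (p : ℕ) [Fact p.Prime] :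
    (∑ m ∈ Finset.range p, C ((legendreSym p m : ℤ) : ZMod 2) * X ^ m) =
      X * ∑ i ∈ Finset.range (p - 1), (X : (ZMod 2)[X]) ^ i := by
  have hp : p.Prime := Fact.out
  have hr : Finset.range p = Finset.range (p - 1 + 1) := by
    congr 1; have := hp.one_lt; omega
  rw [hr, Finset.sum_range_succ']
  simp only [Nat.cast_zero, legendreSym.at_zero, Int.cast_zero, map_zero, zero_mul, add_zero]
  rw [Finset.mul_sum]
  refine Finset.sum_congr rfl fun i hi => ?_
  rw [Finset.mem_range] at hi
  have hne : ((((i + 1 : ℕ) : ℤ)) : ZMod p) ≠ 0 := by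
    rw [Int.cast_natCast, Ne, ZMod.natCast_eq_zero_iff]
    exact Nat.not_dvd_of_pos_of_lt (by omega) (by omega)
  have h1 : (((legendreSym p ((i + 1 : ℕ) : ℤ)) : ℤ) : ZMod 2) = 1 := by
    rcases legendreSym.eq_one_or_neg_one p hne with h | h
    · rw [h]; simp
    · rw [h]; decide
  rw [h1, map_one, one_mul, pow_succ']

/-- **Digit splittings of the mod-2 shadow**: for every factorisation `p - 1 = a·t`,
`F_p ≡ (X·Σ_{i<a} X^i)·(Σ_{j<t} X^{aj}) (mod 2)`, with `|supp A| ≤ a`, `|supp B| ≤ t`. -/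
theorem fekete_mod_two_digit_split (p : ℕ) [Fact p.Prime] (a t : ℕ) (hat : a * t = p - 1) :
    ∃ A B : (ZMod 2)[X],
      A * B = ∑ m ∈ Finset.range p, C ((legendreSym p m : ℤ) : ZMod 2) * X ^ m ∧
      A.support.card ≤ a ∧ B.support.card ≤ t := by
  refine ⟨X * ∑ i ∈ range a, X ^ i, ∑ j ∈ range t, X ^ (a * j), ?_, ?_, ?_⟩
  · rw [fekete_mod_two_eq, mul_assoc, geom_mul_comb, hat]
  · refine (card_support_mul_le).trans ?_
    rw [support_X, Finset.card_singleton, one_mul]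
    exact card_support_sum_X_pow_le (ZMod 2) (fun i => i) a
  · exact card_support_sum_X_pow_le (ZMod 2) (fun j => a * j) t

/-- `17` is prime (local instance). -/
theorem fact_prime_seventeen : Fact (Nat.Prime 17) := ⟨by norm_num⟩

attribute [local instance] fact_prime_seventeen

/-- `p = 17 = 4·4 + 1`: modulo `2`, `F_17 ≡ (X + X² + X³ + X⁴)·(1 + X⁴ + X⁸ + X¹²)`, support-sum `≤ 8 < 10 = (17+3)/2`
— below the line's bound, which every COMPLEX splitting of `F_17` respects (exhaustive minimum `14`). -/
theorem fekete_seventeen_mod_two_split : ∃ A B : (ZMod 2)[X],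
    A * B = ∑ m ∈ Finset.range 17, C ((legendreSym 17 m : ℤ) : ZMod 2) * X ^ m ∧
    A.support.card + B.support.card < (17 + 3) / 2 := by
  obtain ⟨A, B, h, hA, hB⟩ := fekete_mod_two_digit_split 17 4 4 (by norm_num)
  exact ⟨A, B, h, by omega⟩

/-- **The mod-2 shadow of the line's bound is FALSE** (so the place of reduction must lie over `p`): it is not
true that for every odd prime `p` every factorisation of `F_p mod 2` in `𝔽₂[X]` has support-sum `≥ (p+3)/2`
(witness `p = 17`, support-sum `8`). -/
theorem not_feketeModTwoShadowBound :
    ¬ ∀ (p : ℕ) [Fact p.Prime], p ≠ 2 → ∀ A B : (ZMod 2)[X],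
        A * B = ∑ m ∈ Finset.range p, C ((legendreSym p m : ℤ) : ZMod 2) * X ^ m →
        (p + 3) / 2 ≤ A.support.card + B.support.card := by
  intro H
  obtain ⟨A, B, h, hlt⟩ := fekete_seventeen_mod_two_split
  have := H 17 (by norm_num) A B h
  omega

/-! ## §B  Tightness of the line's bound `(p+3)/2`; trivial splittings are not optimal -/

/-- `5` is prime (local instance). -/
theorem fact_prime_five : Fact (Nat.Prime 5) := ⟨by norm_num⟩
/-- `11` is prime (local instance). -/
theorem fact_prime_eleven : Fact (Nat.Prime 11) := ⟨by norm_num⟩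
attribute [local instance] fact_prime_five fact_prime_eleven

/-- `F_3 = X - X²`. -/
theorem fekete_three_eq :
    (∑ m ∈ Finset.range 3, C ((legendreSym 3 m : ℤ) : ℂ) * X ^ m) = X - X ^ 2 := by
  simp [Finset.sum_range_succ]
  norm_num
  ring

/-- `F_5 = X - X² - X³ + X⁴`. -/
theorem fekete_five_eq :
    (∑ m ∈ Finset.range 5, C ((legendreSym 5 m : ℤ) : ℂ) * X ^ m) = X - X ^ 2 - X ^ 3 + X ^ 4 := by
  simp [Finset.sum_range_succ]
  norm_num
  ring

/-- `F_11` explicitly (quadratic residues mod 11: `1,3,4,5,9`). -/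
theorem fekete_eleven_eq :
    (∑ m ∈ Finset.range 11, C ((legendreSym 11 m : ℤ) : ℂ) * X ^ m) =
      X - X ^ 2 + X ^ 3 + X ^ 4 + X ^ 5 - X ^ 6 - X ^ 7 - X ^ 8 + X ^ 9 - X ^ 10 := by
  simp [Finset.sum_range_succ]
  norm_num
  ring

/-- `X - X²` has two monomials. -/
theorem card_support_X_sub_X_sq : ((X - X ^ 2 : ℂ[X])).support.card = 2 := by
  have : (X - X ^ 2 : ℂ[X]) = C 1 * X ^ 1 + C (-1) * X ^ 2 := by simp; ring
  rw [this, card_support_binomial (by norm_num) (by norm_num) (by norm_num)]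

/-- `1 - X²` has two monomials. -/
theorem card_support_one_sub_X_sq : ((1 - X ^ 2 : ℂ[X])).support.card = 2 := by
  have : (1 - X ^ 2 : ℂ[X]) = C 1 * X ^ 0 + C (-1) * X ^ 2 := by simp; ring
  rw [this, card_support_binomial (by norm_num) (by norm_num) (by norm_num)]

/-- `1 - X` has two monomials. -/
theorem card_support_one_sub_X : ((1 - X : ℂ[X])).support.card = 2 := by
  have : (1 - X : ℂ[X]) = C 1 * X ^ 0 + C (-1) * X ^ 1 := by simp; ring
  rw [this, card_support_binomial (by norm_num) (by norm_num) (by norm_num)]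

/-- `p = 3`: the line's bound `(p+3)/2 = 3` is attained, `F_3 = X·(1 - X)`. -/
theorem tight_at_three : ∃ A B : ℂ[X],
    A * B = ∑ m ∈ Finset.range 3, C ((legendreSym 3 m : ℤ) : ℂ) * X ^ m ∧
    A.support.card + B.support.card = (3 + 3) / 2 := by
  refine ⟨X, 1 - X, ?_, ?_⟩
  · rw [fekete_three_eq]; ring
  · rw [card_support_one_sub_X, support_X, Finset.card_singleton]

/-- `p = 5`: the line's bound `(p+3)/2 = 4` is attained, `F_5 = (X - X²)(1 - X²)` — the last prime at which
it is tight in the exhaustive data (`p = 7, …, 29`: minima `7,9,10,14,15,23,22 > (p+3)/2`). -/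
theorem tight_at_five : ∃ A B : ℂ[X],
    A * B = ∑ m ∈ Finset.range 5, C ((legendreSym 5 m : ℤ) : ℂ) * X ^ m ∧
    A.support.card + B.support.card = (5 + 3) / 2 := by
  refine ⟨X - X ^ 2, 1 - X ^ 2, ?_, ?_⟩
  · rw [fekete_five_eq]; ring
  · rw [card_support_X_sub_X_sq, card_support_one_sub_X_sq]

/-- NATURAL STRENGTHENING REFUTED: "trivial splittings are optimal", i.e. `p ≤ |supp A| + |supp B|` for
every prime `p` and every splitting, fails (already at `p = 5`; also at `p = 11, 13, 17, 19, 29` by the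
`(x∓1)`-peel, see `peel_at_eleven`). -/
theorem not_trivialSplittingOptimal :
    ¬ ∀ (p : ℕ) [Fact p.Prime] (A B : ℂ[X]),
      A * B = ∑ m ∈ Finset.range p, C ((legendreSym p m : ℤ) : ℂ) * X ^ m →
        (p : ℝ) ≤ (A.support.card : ℝ) + (B.support.card : ℝ) := by
  intro H
  obtain ⟨A, B, hAB, hcard⟩ := tight_at_five
  have h := H 5 A B hAB
  have h' : ((A.support.card : ℝ) + (B.support.card : ℝ)) = 4 := by
    norm_num at hcard; exact_mod_cast hcard
  have h5 : ((5 : ℕ) : ℝ) = 5 := by norm_num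
  linarith

/-- The peel cofactor at `p = 11`: the partial sums `S_11(k) = (1,0,1,2,3,2,1,0,1)` of the Legendre
symbols mod 11, as a 7-term polynomial. -/
noncomputable def Q11 : ℂ[X] :=
  ∑ i : Fin 7, C ((![1, 1, 2, 3, 2, 1, 1] : Fin 7 → ℂ) i) * X ^ ((![0, 2, 3, 4, 5, 6, 8] : Fin 7 → ℕ) i)

/-- `Q11` has exactly seven monomials. -/
theorem Q11_card : Q11.support.card = 7 := by
  unfold Q11
  apply card_support_eq'
  · decide
  · intro i; fin_cases i <;> norm_num

/-- `Q11 = 1 + X² + 2X³ + 3X⁴ + 2X⁵ + X⁶ + X⁸`. -/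
theorem Q11_eq : Q11 = 1 + X ^ 2 + 2 * X ^ 3 + 3 * X ^ 4 + 2 * X ^ 5 + X ^ 6 + X ^ 8 := by
  unfold Q11
  simp [Fin.sum_univ_succ]
  simp only [map_ofNat]
  ring

/-- `p = 11`: the `(X-1)`-peel `F_11 = (X - X²)·Σ_k S_11(k+1) X^k` has support-sum `2 + 7 = 9 < 11`
(the exhaustive minimum at `p = 11`; two of the nine partial sums vanish). -/
theorem peel_at_eleven : ∃ A B : ℂ[X],
    A * B = ∑ m ∈ Finset.range 11, C ((legendreSym 11 m : ℤ) : ℂ) * X ^ m ∧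
    A.support.card + B.support.card = 9 := by
  refine ⟨X - X ^ 2, Q11, ?_, ?_⟩
  · rw [fekete_eleven_eq, Q11_eq]; ring
  · rw [card_support_X_sub_X_sq, Q11_card]

section Peel

variable (p : ℕ) [Fact p.Prime]

/-- The peel cofactor: partial sums `S_p(k+1) = Σ_{m ≤ k+1} (m|p)` as coefficients. -/
noncomputable def peelCofactor : ℤ[X] :=
  ∑ k ∈ range (p - 2), C (∑ m ∈ range (k + 2), legendreSym p m) * X ^ k

/-- Coefficients of the peel cofactor. -/
theorem coeff_peelCofactor (k : ℕ) :
    (peelCofactor p).coeff k = if k < p - 2 then ∑ m ∈ range (k + 2), legendreSym p m else 0 := by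
  simp only [peelCofactor, finsetSum_coeff, coeff_C_mul_X_pow]
  simp [Finset.mem_range]

/-- **The `(X-1)`-peel identity** over `ℤ`: `(X - X²)·Σ_{k<p-2} S_p(k+1) X^k = F_p` for odd `p`
(coefficient of `X^n`: `S_p(n) - S_p(n-1) = χ_p(n)`, using `S_p(p-1) = Σ_{m<p} χ_p(m) = 0`). -/
theorem X_sub_X_sq_mul_peelCofactor (hp : p ≠ 2) :
    (X - X ^ 2) * peelCofactor p = feketePolynomial p := by
  have hprime : p.Prime := Fact.out
  have hp3 : 3 ≤ p := by have := hprime.two_le; omega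
  ext n
  have h : (X - X ^ 2 : ℤ[X]) * peelCofactor p = X ^ 1 * peelCofactor p - X ^ 2 * peelCofactor p := by
    ring
  rw [h, coeff_sub, coeff_X_pow_mul', coeff_X_pow_mul', coeff_peelCofactor, coeff_peelCofactor,
    coeff_feketePolynomial]
  by_cases h0 : n = 0
  · subst h0
    simp [legendreSym.at_zero]
  by_cases h1 : n = 1
  · subst h1
    rw [if_pos le_rfl, if_pos (by omega), if_neg (by norm_num), if_pos hprime.one_lt, sub_zero,
      show 1 - 1 + 2 = 0 + 1 + 1 by rfl, Finset.sum_range_succ, Finset.sum_range_succ, Finset.sum_range_zero]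
    simp [legendreSym.at_zero]
  by_cases hle : n ≤ p - 2
  · rw [if_pos (by omega), if_pos (by omega), if_pos (by omega), if_pos (by omega), if_pos (by omega),
      show n - 1 + 2 = n + 1 by omega, show n - 2 + 2 = n by omega, Finset.sum_range_succ]
    ring
  by_cases heq : n = p - 1
  · rw [if_pos (by omega), if_neg (by omega), if_pos (by omega), if_pos (by omega), if_pos (by omega),
      zero_sub, show n - 2 + 2 = p - 1 by omega]
    have hsum := sum_range_legendreSym p hp
    have hr : Finset.range p = Finset.range (p - 1 + 1) := by congr 1; omega
    rw [hr, Finset.sum_range_succ] at hsum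
    rw [heq]
    linarith
  · rw [if_pos (by omega), if_neg (by omega), if_pos (by omega), if_neg (by omega), if_neg (by omega),
      sub_zero]

/-- The support of the peel cofactor is the set of indices of non-vanishing partial sums. -/
theorem support_peelCofactor :
    (peelCofactor p).support =
      (range (p - 2)).filter (fun k => ∑ m ∈ range (k + 2), legendreSym p m ≠ 0) := by
  ext k
  rw [mem_support_iff, coeff_peelCofactor, Finset.mem_filter, Finset.mem_range]
  by_cases hk : k < p - 2 <;> simp [hk]

/-- **General peel splitting**: for every odd prime `p`, `F_p = (X - X²)·B` with
`|supp B| = #{k < p-2 : S_p(k+1) ≠ 0}`; hence `min (|supp A|+|supp B|) ≤ 2 + #{1 ≤ k ≤ p-2 : S_p(k) ≠ 0}`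
— the mechanism behind every sub-generic optimum in the exhaustive data. -/
theorem peel_split (hp : p ≠ 2) : ∃ A B : ℂ[X],
    A * B = ∑ m ∈ Finset.range p, C ((legendreSym p m : ℤ) : ℂ) * X ^ m ∧
    A.support.card = 2 ∧
    B.support.card = ((range (p - 2)).filter (fun k => ∑ m ∈ range (k + 2), legendreSym p m ≠ 0)).card := by
  refine ⟨X - X ^ 2, (peelCofactor p).map (Int.castRingHom ℂ), ?_, card_support_X_sub_X_sq, ?_⟩
  · rw [← map_feketePolynomial_complex, ← X_sub_X_sq_mul_peelCofactor p hp, Polynomial.map_mul]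
    simp
  · rw [support_map_of_injective _ (RingHom.injective_int (Int.castRingHom ℂ)), support_peelCofactor]

/-- For `p ≡ 1 (mod 4)` the middle partial sum vanishes: `S_p((p-1)/2) = Σ_{m ≤ (p-1)/2} (m|p) = 0`
(`χ_p` is even, the total sum is `0`, and the two halves agree). -/
theorem sum_half_legendreSym_eq_zero (hp4 : p % 4 = 1) :
    ∑ m ∈ range ((p + 1) / 2), legendreSym p m = 0 := by
  have hprime : p.Prime := Fact.out
  have hp2 : p ≠ 2 := by rintro rfl; norm_num at hp4
  have hneg1 : legendreSym p (-1) = 1 := by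
    rw [legendreSym.at_neg_one hp2, ZMod.χ₄_nat_one_mod_four hp4]
  obtain ⟨h, hh⟩ : ∃ h, p = 2 * h + 1 := ⟨p / 2, by omega⟩
  have hhalf : (p + 1) / 2 = h + 1 := by omega
  have htot := sum_range_legendreSym p hp2
  have hr : Finset.range p = Finset.range ((h + 1) + h) := by congr 1; omega
  rw [hr, Finset.sum_range_add] at htot
  -- the second half equals the first half
  have hsecond : ∑ j ∈ range h, legendreSym p ((h + 1 + j : ℕ) : ℤ) = ∑ m ∈ range (h + 1), legendreSym p m := by
    have hrefl : ∑ j ∈ range h, legendreSym p ((h + 1 + j : ℕ) : ℤ)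
        = ∑ j ∈ range h, legendreSym p ((p - (j + 1) : ℕ) : ℤ) := by
      rw [← Finset.sum_range_reflect (fun j => legendreSym p ((p - (j + 1) : ℕ) : ℤ)) h]
      refine Finset.sum_congr rfl ?_
      intro j hj
      rw [Finset.mem_range] at hj
      congr 2
      omega
    rw [hrefl, Finset.sum_range_succ' (fun m => legendreSym p (m : ℤ)), Nat.cast_zero, legendreSym.at_zero,
      add_zero]
    refine Finset.sum_congr rfl ?_
    intro j hj
    rw [Finset.mem_range] at hj
    rw [legendreSym_natCast_sub p (by omega), neg_eq_neg_one_mul, legendreSym.mul, hneg1, one_mul]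
  rw [hsecond] at htot
  rw [hhalf]
  linarith

/-- For every prime `p ≡ 1 (mod 4)` there is a splitting of `F_p` with support-sum `≤ p - 1 < p`
(the peel, one partial sum vanishing): trivial splittings are NEVER optimal there. -/
theorem peel_split_one_mod_four (hp4 : p % 4 = 1) : ∃ A B : ℂ[X],
    A * B = ∑ m ∈ Finset.range p, C ((legendreSym p m : ℤ) : ℂ) * X ^ m ∧
    A.support.card + B.support.card ≤ p - 1 := by
  have hprime : p.Prime := Fact.out
  have hp2 : p ≠ 2 := by rintro rfl; norm_num at hp4
  have hp5 : 5 ≤ p := by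
    have h2 := hprime.two_le
    have : p ≠ 3 := by rintro rfl; norm_num at hp4
    have : p ≠ 4 := by rintro rfl; exact absurd hprime (by norm_num)
    omega
  obtain ⟨A, B, hAB, hA, hB⟩ := peel_split p hp2
  refine ⟨A, B, hAB, ?_⟩
  have hsub : (range (p - 2)).filter (fun k => ∑ m ∈ range (k + 2), legendreSym p m ≠ 0)
      ⊆ (range (p - 2)).erase ((p - 3) / 2) := by
    intro k hk
    rw [Finset.mem_filter] at hk
    rw [Finset.mem_erase]
    refine ⟨?_, hk.1⟩
    rintro rfl
    apply hk.2
    have : (p - 3) / 2 + 2 = (p + 1) / 2 := by omega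
    rw [this]
    exact sum_half_legendreSym_eq_zero p hp4
  have hcard := Finset.card_le_card hsub
  rw [Finset.card_erase_of_mem (by rw [Finset.mem_range]; omega), Finset.card_range] at hcard
  omega

/-- **NATURAL STRENGTHENING REFUTED, eventual form**: `∃ p₀ ∀ primes p ≥ p₀, every splitting has
support-sum ≥ p` is FALSE (infinitely many `p ≡ 1 (mod 4)` by `Nat.exists_prime_gt_modEq_one`, and the
peel at each of them).  So the exponent-`1` constant of the crux is `< 1` infinitely often; the line gives `≥ 1/2`. -/
theorem not_eventuallyTrivialOptimal :
    ¬ ∃ p₀ : ℕ, ∀ (p : ℕ) [Fact p.Prime], p₀ ≤ p → ∀ (A B : ℂ[X]),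
      A * B = ∑ m ∈ Finset.range p, C ((legendreSym p m : ℤ) : ℂ) * X ^ m →
        (p : ℝ) ≤ (A.support.card : ℝ) + (B.support.card : ℝ) := by
  rintro ⟨p₀, H⟩
  obtain ⟨q, hq, hgt, hmod⟩ := Nat.exists_prime_gt_modEq_one (p₀ + 4) (by norm_num : (4 : ℕ) ≠ 0)
  haveI : Fact q.Prime := ⟨hq⟩
  have hq4 : q % 4 = 1 := by
    have := hmod; unfold Nat.ModEq at this; simpa using this
  obtain ⟨A, B, hAB, hle⟩ := peel_split_one_mod_four q hq4
  have h := H q (by omega) A B hAB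
  have h' : ((A.support.card : ℝ) + (B.support.card : ℝ)) ≤ (q : ℝ) - 1 := by
    have hq1 : 1 ≤ q := hq.one_lt.le
    have : ((A.support.card + B.support.card : ℕ) : ℝ) ≤ ((q - 1 : ℕ) : ℝ) := by exact_mod_cast hle
    push_cast [Nat.cast_sub hq1] at this
    exact this
  linarith

end Peel

/-- **The crux at `δ = 1/2` is false** (cycle 2; landed as `Negative/ExponentHalf.lean`): there is no `p₀` beyond
which every complex splitting has `p^{1/2+1/2} = p ≤ |supp A| + |supp B|`.  With the line's `(p+3)/2` (every
`δ < 1/2` works) the admissible exponents of the crux are exactly `0 < δ < 1/2`. -/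
theorem feketeNoSparseSplit_false_at_delta_half :
    ¬ ∃ p₀ : ℕ, ∀ (p : ℕ) [Fact p.Prime], p₀ ≤ p → ∀ (A B : ℂ[X]),
      A * B = ∑ m ∈ Finset.range p, C ((legendreSym p m : ℤ) : ℂ) * X ^ m →
        (p : ℝ) ^ (1 / 2 + 1 / 2 : ℝ) ≤ (A.support.card : ℝ) + (B.support.card : ℝ) := by
  rintro ⟨p₀, H⟩
  apply not_eventuallyTrivialOptimal
  refine ⟨p₀, ?_⟩
  intro p _ hp A B hAB
  have h := H p hp A B hAB
  have hhalf : (1 / 2 + 1 / 2 : ℝ) = 1 := by norm_num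
  rwa [hhalf, Real.rpow_one] at h


/-! ## §C  The modulus must be prime: the Jacobi analogue at `N = 15` beats `(N+3)/2` -/

/-- The Jacobi–Fekete polynomial of `N = 15` explicitly. -/
theorem jacobiFekete_fifteen_eq :
    (∑ m ∈ Finset.range 15, C ((jacobiSym m 15 : ℤ) : ℂ) * X ^ m) =
      X + X ^ 2 + X ^ 4 - X ^ 7 + X ^ 8 - X ^ 11 - X ^ 13 - X ^ 14 := by
  simp [Finset.sum_range_succ]
  norm_num
  ring

/-- The 6-term cofactor `1 + X + X³ + X⁵ + X⁷ + X⁸` of `X - X⁶` in `F_15`. -/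
noncomputable def Q15 : ℂ[X] :=
  ∑ i : Fin 6, C ((![1, 1, 1, 1, 1, 1] : Fin 6 → ℂ) i) * X ^ ((![0, 1, 3, 5, 7, 8] : Fin 6 → ℕ) i)

/-- `Q15` has exactly six monomials. -/
theorem Q15_card : Q15.support.card = 6 := by
  unfold Q15
  apply card_support_eq'
  · decide
  · intro i; fin_cases i <;> norm_num

/-- `Q15 = 1 + X + X³ + X⁵ + X⁷ + X⁸`. -/
theorem Q15_eq : Q15 = 1 + X + X ^ 3 + X ^ 5 + X ^ 7 + X ^ 8 := by
  unfold Q15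
  simp [Fin.sum_univ_succ]
  ring

/-- `X - X⁶` has two monomials. -/
theorem card_support_X_sub_X_pow_six : ((X - X ^ 6 : ℂ[X])).support.card = 2 := by
  have : (X - X ^ 6 : ℂ[X]) = C 1 * X ^ 1 + C (-1) * X ^ 6 := by simp; ring
  rw [this, card_support_binomial (by norm_num) (by norm_num) (by norm_num)]

/-- `N = 15 = 3·5`: `F_15 = (X - X⁶)·(1 + X + X³ + X⁵ + X⁷ + X⁸)`, support-sum `8 < 9 = (15+3)/2` — the
char-`p` multiplicity lever (and its bound) is specific to PRIME moduli. -/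
theorem jacobi_fifteen_split : ∃ A B : ℂ[X],
    A * B = ∑ m ∈ Finset.range 15, C ((jacobiSym m 15 : ℤ) : ℂ) * X ^ m ∧
    A.support.card + B.support.card < (15 + 3) / 2 := by
  refine ⟨X - X ^ 6, Q15, ?_, ?_⟩
  · rw [jacobiFekete_fifteen_eq, Q15_eq]; ring
  · rw [card_support_X_sub_X_pow_six, Q15_card]; norm_num

/-! ## §C2  `C⁺` without primality (cycle 2): the cyclic Jacobi analogue reaches the COUNTING bound at
`N = 15`; the polynomial one fails at the prime power `N = 9` -/

/-- The second CRT factor at `N = 15`, `F₅(X⁶) mod (X¹⁵ - 1) = X⁶ - X¹² - X³ + X⁹`, in injective-exponent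
form. -/
theorem B15cyc_eq_sum : (X ^ 6 - X ^ 12 - X ^ 3 + X ^ 9 : ℂ[X]) =
    ∑ i : Fin 4, C ((![1, -1, -1, 1] : Fin 4 → ℂ) i) * X ^ ((![6, 12, 3, 9] : Fin 4 → ℕ) i) := by
  simp [Fin.sum_univ_succ]
  ring

/-- `X⁶ - X¹² - X³ + X⁹` has exactly four monomials. -/
theorem card_support_B15cyc : ((X ^ 6 - X ^ 12 - X ^ 3 + X ^ 9 : ℂ[X])).support.card = 4 := by
  rw [B15cyc_eq_sum]
  apply card_support_eq'
  · decide
  · intro i; fin_cases i <;> norm_num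

/-- `deg (X⁶ - X¹² - X³ + X⁹) ≤ 12`. -/
theorem natDegree_B15cyc_le : ((X ^ 6 - X ^ 12 - X ^ 3 + X ^ 9 : ℂ[X])).natDegree ≤ 12 := by
  rw [B15cyc_eq_sum]
  refine natDegree_sum_le_of_forall_le _ _ ?_
  intro i _
  refine (natDegree_C_mul_X_pow_le _ _).trans ?_
  fin_cases i <;> simp

/-- `X¹⁰ - X⁵` has two monomials. -/
theorem card_support_X_pow_ten_sub_X_pow_five : ((X ^ 10 - X ^ 5 : ℂ[X])).support.card = 2 := by
  have : (X ^ 10 - X ^ 5 : ℂ[X]) = C 1 * X ^ 10 + C (-1) * X ^ 5 := by simp; ring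
  rw [this, card_support_binomial (by norm_num) (by norm_num) (by norm_num)]

/-- **CRT cyclic splitting at `N = 15`** (BarrierNotes-ideator3 §B4 as a theorem):
`(X¹⁰ - X⁵)·(X⁶ - X¹² - X³ + X⁹) ≡ F₁₅ (mod X¹⁵ - 1)`, both degrees `< 15`, support-sum `2 + 4 = 6` — the
cyclic counting bound `⌈2√8⌉` (`|supp F₁₅| = φ(15) = 8`), far below `(15+3)/2 = 9`.  `X¹⁰ - X⁵ = F₃(X¹⁰)` and
`X⁶ - X¹² - X³ + X⁹ = F₅(X⁶)` reduced mod `X¹⁵ - 1` (`10 ≡ (1,0)`, `6 ≡ (0,1) mod (3,5)`); quotient `X + X² + X⁴ - X⁷`. -/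
theorem jacobi_fifteen_cyclic_split : ∃ A B : ℂ[X],
    A.natDegree < 15 ∧ B.natDegree < 15 ∧
    (X ^ 15 - 1 : ℂ[X]) ∣ A * B - ∑ m ∈ Finset.range 15, C ((jacobiSym m 15 : ℤ) : ℂ) * X ^ m ∧
    A.support.card + B.support.card = 6 := by
  refine ⟨X ^ 10 - X ^ 5, X ^ 6 - X ^ 12 - X ^ 3 + X ^ 9, ?_,
    lt_of_le_of_lt natDegree_B15cyc_le (by norm_num), ?_, ?_⟩
  · refine lt_of_le_of_lt (natDegree_sub_le _ _) ?_
    rw [natDegree_X_pow, natDegree_X_pow]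
    norm_num
  · rw [jacobiFekete_fifteen_eq]
    exact ⟨X + X ^ 2 + X ^ 4 - X ^ 7, by ring⟩
  · rw [card_support_X_pow_ten_sub_X_pow_five, card_support_B15cyc]

/-- **`C⁺` needs a PRIME modulus** (NATURAL STRENGTHENING REFUTED): the cyclic bound `(N+3)/2` stated for the
Jacobi symbol at all odd `N ≥ 3` — for prime `N` verbatim the line's `FeketeNoSparseCyclicSplit`, as
`(m|p) = J(m|p)` — is FALSE at the squarefree `N = 15` (support-sum `6`). -/
theorem not_jacobiNoSparseCyclicSplit :
    ¬ ∀ (N : ℕ), Odd N → 3 ≤ N → ∀ A B : ℂ[X], A.natDegree < N → B.natDegree < N →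
        (X ^ N - 1 : ℂ[X]) ∣ A * B - ∑ m ∈ Finset.range N, C ((jacobiSym m N : ℤ) : ℂ) * X ^ m →
        (N + 3) / 2 ≤ A.support.card + B.support.card := by
  intro H
  obtain ⟨A, B, hA, hB, hdiv, hcard⟩ := jacobi_fifteen_cyclic_split
  have h := H 15 (by decide) (by norm_num) A B hA hB hdiv
  omega

/-- The Jacobi–Fekete polynomial of `N = 9 = 3²`: the symbol is principal on units, `F₉ = Σ_{3 ∤ m < 9} X^m`. -/
theorem jacobiFekete_nine_eq :
    (∑ m ∈ Finset.range 9, C ((jacobiSym m 9 : ℤ) : ℂ) * X ^ m) =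
      X + X ^ 2 + X ^ 4 + X ^ 5 + X ^ 7 + X ^ 8 := by
  simp [Finset.sum_range_succ]
  norm_num

/-- `X + X²` has two monomials. -/
theorem card_support_X_add_X_sq : ((X + X ^ 2 : ℂ[X])).support.card = 2 := by
  have : (X + X ^ 2 : ℂ[X]) = C 1 * X ^ 1 + C 1 * X ^ 2 := by simp
  rw [this, card_support_binomial (by norm_num) (by norm_num) (by norm_num)]

/-- `1 + X³ + X⁶` has three monomials. -/
theorem card_support_one_add_X_pow_three_add_X_pow_six :
    ((1 + X ^ 3 + X ^ 6 : ℂ[X])).support.card = 3 := by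
  have : (1 + X ^ 3 + X ^ 6 : ℂ[X]) = C 1 * X ^ 0 + C 1 * X ^ 3 + C 1 * X ^ 6 := by simp
  rw [this, card_support_trinomial (by norm_num) (by norm_num) (by norm_num) (by norm_num) (by norm_num)]

/-- **Prime power**: `F₉ = (X + X²)·(1 + X³ + X⁶)`, an honest polynomial splitting of support-sum
`5 < 6 = (9+3)/2` (digit tiling of the units mod `9`). -/
theorem jacobi_nine_split : ∃ A B : ℂ[X],
    A * B = ∑ m ∈ Finset.range 9, C ((jacobiSym m 9 : ℤ) : ℂ) * X ^ m ∧
    A.support.card + B.support.card = 5 := by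
  refine ⟨X + X ^ 2, 1 + X ^ 3 + X ^ 6, ?_, ?_⟩
  · rw [jacobiFekete_nine_eq]; ring
  · rw [card_support_X_add_X_sq, card_support_one_add_X_pow_three_add_X_pow_six]

/-- **Even the polynomial bound `(N+3)/2` needs `N` prime, not only odd** (NATURAL STRENGTHENING REFUTED):
FALSE at `N = 9` (support-sum `5`), and at `N = 15` (`8`, `jacobi_fifteen_split`, cycle 1). -/
theorem not_jacobiNoSparseSplit :
    ¬ ∀ (N : ℕ), Odd N → 3 ≤ N → ∀ A B : ℂ[X],
        A * B = ∑ m ∈ Finset.range N, C ((jacobiSym m N : ℤ) : ℂ) * X ^ m →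
        (N + 3) / 2 ≤ A.support.card + B.support.card := by
  intro H
  obtain ⟨A, B, hAB, hcard⟩ := jacobi_nine_split
  have h := H 9 (by decide) (by norm_num) A B hAB
  omega

/-! ## §D  The line's stubs, hypothesis by hypothesis (cycle 2)

`-- Targets`: none yet (payload `stuck_stubs = []`; the lead has not started).  Pre-emptive analysis of the
four REGISTERED stub signatures of `Lines/cyclic-valuation-dichotomy.lean` (quoted verbatim with one hypothesis
deleted; the skeleton itself is not imported here).  Summary: stubs 1 and 3 use every hypothesis they state
(two of them only through Mathlib's convention `rootMultiplicity a 0 = 0` / `supp 0 = ∅`); stub 2's `p ≠ 2` is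
removable; stub 4's `A ≠ 0, B ≠ 0` are derivable.  No stub is false; none is vacuous (`stub_charPFewnomial_tight`
inhabits stub 1 at the bound, `F = fekete`, `A·B = F_p` inhabit 3 and 4). -/

section CharP

variable (K : Type*) [Field K] (p : ℕ) [Fact p.Prime] [CharP K p]

/-- Frobenius: `(X - 1)^p = X^p - 1` in `K[X]` when `char K = p`. -/
theorem X_sub_C_one_pow_char : (X - C (1 : K)) ^ p = X ^ p - 1 := by
  rw [sub_pow_char, ← C_pow, one_pow, C_1]

omit [CharP K p] in
/-- `X^p - 1` has exactly two monomials. -/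
theorem card_support_X_pow_sub_one : ((X : K[X]) ^ p - 1).support.card = 2 := by
  have hp : p ≠ 0 := (Fact.out : p.Prime).ne_zero
  have h : ((X : K[X]) ^ p - 1) = C 1 * X ^ p + C (-1) * X ^ 0 := by
    simp only [map_one, map_neg, one_mul, pow_zero, mul_one]
    ring
  rw [h, card_support_binomial hp one_ne_zero (neg_ne_zero.mpr one_ne_zero)]

omit [CharP K p] in
/-- `X^p - 1 ≠ 0`. -/
theorem X_pow_sub_one_ne_zero' : ((X : K[X]) ^ p - 1) ≠ 0 := by
  intro h
  have h2 := card_support_X_pow_sub_one K p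
  rw [h, support_zero, Finset.card_empty] at h2
  exact absurd h2 (by norm_num)

omit [Fact p.Prime] [CharP K p] in
/-- **Stub 1 is tight**: for every `m < p`, `(X-1)^m` is non-zero, of degree `m < p`, divisible by `(X-1)^m`,
with at most `m + 1` monomials — the stub's `m + 1` cannot be improved. -/
theorem stub_charPFewnomial_tight (m : ℕ) (hm : m < p) :
    ∃ g : K[X], g ≠ 0 ∧ g.natDegree < p ∧ (X - C (1 : K)) ^ m ∣ g ∧ g.support.card ≤ m + 1 := by
  have hdeg : ((X - C (1 : K)) ^ m).natDegree = m := by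
    rw [natDegree_pow, natDegree_X_sub_C, mul_one]
  refine ⟨(X - C 1) ^ m, pow_ne_zero _ (X_sub_C_ne_zero 1), by omega, dvd_rfl, ?_⟩
  calc ((X - C (1 : K)) ^ m).support.card ≤ ((X - C (1 : K)) ^ m).natDegree + 1 :=
        card_supp_le_succ_natDegree _
    _ = m + 1 := by rw [hdeg]

end CharP

/-- **Stub 1: `natDegree g < p` is load-bearing** — without it, `g = X^p - 1 = (X-1)^p` has multiplicity `p`
at `1` but two monomials (`p = 3`, `K = ZMod 3`). -/
theorem stub_charPFewnomial_false_without_natDegree_lt :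
    ¬ ∀ (K : Type) [Field K] (p : ℕ) [Fact p.Prime] [CharP K p] (g : K[X]) (m : ℕ),
        g ≠ 0 → (X - C (1 : K)) ^ m ∣ g → m + 1 ≤ g.support.card := by
  intro H
  have h := H (ZMod 3) 3 ((X : (ZMod 3)[X]) ^ 3 - 1) 3 (X_pow_sub_one_ne_zero' (ZMod 3) 3)
    (by rw [X_sub_C_one_pow_char])
  rw [card_support_X_pow_sub_one] at h
  omega

/-- **Stub 1: `CharP K p` is load-bearing** (the degree bound must be measured against the characteristic
of `K`): `K = ZMod 2`, `p = 3`, `g = X² - 1 = (X-1)²`: degree `2 < 3`, multiplicity `2`, two monomials. -/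
theorem stub_charPFewnomial_false_without_charP :
    ¬ ∀ (K : Type) [Field K] (p : ℕ) [Fact p.Prime] (g : K[X]) (m : ℕ),
        g ≠ 0 → g.natDegree < p → (X - C (1 : K)) ^ m ∣ g → m + 1 ≤ g.support.card := by
  intro H
  have hdeg : ((X : (ZMod 2)[X]) ^ 2 - 1).natDegree < 3 := by
    rw [← C_1, natDegree_X_pow_sub_C]; norm_num
  have h := H (ZMod 2) 3 ((X : (ZMod 2)[X]) ^ 2 - 1) 2 (X_pow_sub_one_ne_zero' (ZMod 2) 2) hdeg
    (by rw [X_sub_C_one_pow_char])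
  rw [card_support_X_pow_sub_one] at h
  omega

/-- Stub 1: `g ≠ 0` is (trivially) load-bearing — `g = 0`, `m = 0`. -/
theorem stub_charPFewnomial_false_without_ne_zero :
    ¬ ∀ (K : Type) [Field K] (p : ℕ) [Fact p.Prime] [CharP K p] (g : K[X]) (m : ℕ),
        g.natDegree < p → (X - C (1 : K)) ^ m ∣ g → m + 1 ≤ g.support.card := by
  intro H
  have h := H (ZMod 2) 2 0 0 (by simp) (dvd_zero _)
  simp at h

/-- **Stub 2: `p ≠ 2` is NOT load-bearing** — `F_2 = (0|2)·1 + (1|2)·X = X` has order `0 = (2-1)/2` at `1`,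
in every field. -/
theorem feketeModPOrder_at_two (K : Type*) [Field K] :
    rootMultiplicity (1 : K) (∑ m ∈ Finset.range 2, C ((legendreSym 2 m : ℤ) : K) * X ^ m) = (2 - 1) / 2 := by
  have hF : (∑ m ∈ Finset.range 2, C ((legendreSym 2 m : ℤ) : K) * X ^ m) = X := by
    simp [Finset.sum_range_succ, legendreSym.at_zero, legendreSym.at_one]
  have h2 : (2 - 1) / 2 = 0 := by norm_num
  rw [h2, hF]
  exact rootMultiplicity_eq_zero (by simp)

/-- **Stub 3: `F ≠ 0` is load-bearing** — `F = 0`, `c = 1`, `A = X^p - 1`, `B = 1`: divisibility holds,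
`ord₁ A + ord₁ B ≥ 1 > 0 = ord₁ 0` (`p = 3`). -/
theorem stub_cyclicOrderDichotomy_false_without_F_ne_zero :
    ¬ ∀ (K : Type) [Field K] (p : ℕ) [Fact p.Prime] [CharP K p] (A B F : K[X]) (c : K),
      A ≠ 0 → B ≠ 0 → F.natDegree < p →
      (X ^ p - 1 : K[X]) ∣ A * B - C c * F →
        (c ≠ 0 → rootMultiplicity (1 : K) A + rootMultiplicity (1 : K) B = rootMultiplicity (1 : K) F) ∧
        (c = 0 → p ≤ rootMultiplicity (1 : K) A + rootMultiplicity (1 : K) B) := by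
  intro H
  have hne := X_pow_sub_one_ne_zero' (ZMod 3) 3
  have h := (H (ZMod 3) 3 (X ^ 3 - 1) 1 0 1 hne one_ne_zero (by simp) (by simp)).1 one_ne_zero
  have hpos : 0 < rootMultiplicity (1 : ZMod 3) ((X : (ZMod 3)[X]) ^ 3 - 1) := by
    rw [rootMultiplicity_pos hne]
    simp
  rw [rootMultiplicity_zero] at h
  omega

/-- **Stub 3: `natDegree F < p` is load-bearing** — `F = (X-1)^{p+1}`, `A = (X-1)^p`, `B = 1`, `c = 1`:
`AB - F = (X-1)^p (2 - X) = (X^p - 1)(2 - X)`, `c ≠ 0`, but `ord₁ A + ord₁ B = p ≠ p + 1 = ord₁ F` (`p = 3`).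
(Only `ord₁ F < p` is really used.) -/
theorem stub_cyclicOrderDichotomy_false_without_natDegree_lt :
    ¬ ∀ (K : Type) [Field K] (p : ℕ) [Fact p.Prime] [CharP K p] (A B F : K[X]) (c : K),
      A ≠ 0 → B ≠ 0 → F ≠ 0 →
      (X ^ p - 1 : K[X]) ∣ A * B - C c * F →
        (c ≠ 0 → rootMultiplicity (1 : K) A + rootMultiplicity (1 : K) B = rootMultiplicity (1 : K) F) ∧
        (c = 0 → p ≤ rootMultiplicity (1 : K) A + rootMultiplicity (1 : K) B) := by
  intro H
  have hdiv : ((X : (ZMod 3)[X]) ^ 3 - 1) ∣ (X - C 1) ^ 3 * 1 - C 1 * (X - C 1) ^ 4 := by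
    refine ⟨1 - (X - C 1), ?_⟩
    rw [← X_sub_C_one_pow_char (ZMod 3) 3, C_1]
    ring
  have h := (H (ZMod 3) 3 ((X - C 1) ^ 3) 1 ((X - C 1) ^ 4) 1 (pow_ne_zero _ (X_sub_C_ne_zero 1))
    one_ne_zero (pow_ne_zero _ (X_sub_C_ne_zero 1)) hdiv).1 one_ne_zero
  rw [rootMultiplicity_X_sub_C_pow, rootMultiplicity_X_sub_C_pow, ← C_1, rootMultiplicity_C] at h
  omega

/-- Stub 3: `A ≠ 0` is (by convention) load-bearing, on the cancelling branch `c = 0` — `A = 0`, `B = F = 1`,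
`c = 0`: `p ≤ ord₁ 0 + ord₁ 1 = 0` fails.  (On `c ≠ 0`, `A ≠ 0` follows from the rest.) -/
theorem stub_cyclicOrderDichotomy_false_without_A_ne_zero :
    ¬ ∀ (K : Type) [Field K] (p : ℕ) [Fact p.Prime] [CharP K p] (A B F : K[X]) (c : K),
      B ≠ 0 → F ≠ 0 → F.natDegree < p →
      (X ^ p - 1 : K[X]) ∣ A * B - C c * F →
        (c ≠ 0 → rootMultiplicity (1 : K) A + rootMultiplicity (1 : K) B = rootMultiplicity (1 : K) F) ∧
        (c = 0 → p ≤ rootMultiplicity (1 : K) A + rootMultiplicity (1 : K) B) := by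
  intro H
  have h := (H (ZMod 3) 3 0 1 1 0 one_ne_zero one_ne_zero (by simp) (by simp)).2 rfl
  rw [rootMultiplicity_zero, ← C_1, rootMultiplicity_C] at h
  omega


/-! ## §B2  The peel deficiency (cycle 3): `≥ p - 2` eventually is FALSE; `χ_p(2) = -1` forces two zeros, `p ≡ 5 (8)` three
(landed as `Negative/PeelDeficiency.lean`)

Negative-side boundary facts (refuter-cdisprove-stmt-ValiantsHypothesis-3997-g3-0), PROVED, no new facts; sharpens
`Negative/SmallModels.not_eventuallyTrivialOptimal` (cycle 1: `≥ p` eventually is false).  The `(X - X²)`-peel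
`F_p = (X - X²)·Σ_k S_p(k+1) X^k` (`S_p(k) = Σ_{m≤k} χ_p(m)`) has support-sum `p - Z_p`, `Z_p = #{1 ≤ k ≤ p-2 : S_p(k) = 0}`.
Here: `χ_p(2) = -1` (i.e. `p ≡ ±3 mod 8`) forces the two zeros `S_p(2) = 0` and `S_p(p-3) = -(χ_p(-2) + χ_p(-1)) = 0`
(`sum_range_three_legendreSym_eq_zero`, `sum_range_sub_two_legendreSym_eq_zero`), so `peel_split_le_sub_two`: support-sum
`≤ p - 2` for every prime `p ≡ 3, 5 (mod 8)`, `p ≥ 11`; and for `p ≡ 5 (mod 8)` the central zero `S_p((p-1)/2) = 0`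
(`sum_half_legendreSym_eq_zero`, cycle 1) is a third one, `peel_split_le_sub_three`: `≤ p - 3` (`p ≥ 13`).  With
Dirichlet's theorem for `5 mod 8` (Mathlib `Nat.forall_exists_prime_gt_and_modEq`): `not_eventually_ge_sub_two` — even
`∃ p₀ ∀ p ≥ p₀, p - 2 ≤ |supp A| + |supp B|` is FALSE.  Numerics (cycle 3, `p < 4000`): `Z_p ≥ 3` for all `p ≡ 1, 5 (8)` with
`p ≥ 13`, `≥ 2` for `p ≡ 3 (8)` with `p ≥ 11`, but `Z_p = 0` for 92 of the 139 primes `p ≡ 7 (8)` (positivity bias of `S_p`); mean `Z_p/√p ≈ 1.28`,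
`max Z_p/p ≈ 0.065`: the deficiency is `Θ(√p)`-sized on average and never an exponent — consistent with the crux and
the line, and with "trivial splittings optimal for infinitely many `p ≡ 7 (8)`" being plausible but tied to the open
positivity problem for Legendre partial sums (Baker–Montgomery).
-/

section PeelDeficiency

variable (p : ℕ) [Fact p.Prime]

/-- `χ_p(2) = -1` for `p ≡ 3, 5 (mod 8)` (second supplement). -/
theorem legendreSym_two_eq_neg_one (h8 : p % 8 = 3 ∨ p % 8 = 5) : legendreSym p 2 = -1 := by
  have hp2 : p ≠ 2 := by rintro rfl; norm_num at h8
  rw [legendreSym.at_two hp2, ZMod.χ₈_nat_eq_if_mod_eight]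
  have hodd : p % 2 ≠ 0 := by omega
  rw [if_neg hodd, if_neg (by omega)]

/-- `S_p(2) = χ_p(0) + χ_p(1) + χ_p(2) = 0` when `χ_p(2) = -1`. -/
theorem sum_range_three_legendreSym_eq_zero (h2 : legendreSym p 2 = -1) :
    ∑ m ∈ range 3, legendreSym p m = 0 := by
  simp [Finset.sum_range_succ, legendreSym.at_zero, legendreSym.at_one]
  rw [h2]
  norm_num

/-- `S_p(p-3) = -(χ_p(p-2) + χ_p(p-1)) = -χ_p(-1)·(χ_p(2) + 1) = 0` when `χ_p(2) = -1` (`p ≥ 3`). -/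
theorem sum_range_sub_two_legendreSym_eq_zero (h2 : legendreSym p 2 = -1) (hp3 : 3 ≤ p) :
    ∑ m ∈ range (p - 2), legendreSym p m = 0 := by
  have hp2 : p ≠ 2 := by omega
  have htot := Literature.NumberTheory.LFunctions.sum_range_legendreSym p hp2
  have hr : Finset.range p = Finset.range (p - 2 + 1 + 1) := by congr 1; omega
  rw [hr, Finset.sum_range_succ, Finset.sum_range_succ] at htot
  have e1 : (p - 2 + 1 : ℕ) = p - 1 := by omega
  have hm1 : legendreSym p ((p - 2 + 1 : ℕ) : ℤ) = legendreSym p (-1) := by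
    rw [e1, Literature.NumberTheory.LFunctions.legendreSym_natCast_sub p (by omega : 1 ≤ p)]
    norm_num
  have hm2 : legendreSym p ((p - 2 : ℕ) : ℤ) = -legendreSym p (-1) := by
    rw [Literature.NumberTheory.LFunctions.legendreSym_natCast_sub p (by omega : 2 ≤ p),
      show (-(2 : ℕ) : ℤ) = (-1) * 2 by norm_num, legendreSym.mul, h2]
    ring
  rw [hm1, hm2] at htot
  linarith

/-- **Peel with two forced zeros**: for every prime `p ≡ 3, 5 (mod 8)` with `p ≥ 11` there is a splitting of `F_p`
with support-sum `≤ p - 2` (the peel; `S_p(2) = S_p(p-3) = 0`). -/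
theorem peel_split_le_sub_two (h8 : p % 8 = 3 ∨ p % 8 = 5) (hp11 : 11 ≤ p) : ∃ A B : ℂ[X],
    A * B = ∑ m ∈ Finset.range p, C ((legendreSym p m : ℤ) : ℂ) * X ^ m ∧
    A.support.card + B.support.card ≤ p - 2 := by
  have hp2 : p ≠ 2 := by omega
  have h2 := legendreSym_two_eq_neg_one p h8
  obtain ⟨A, B, hAB, hA, hB⟩ := peel_split p hp2
  refine ⟨A, B, hAB, ?_⟩
  have hsub : (range (p - 2)).filter (fun k => ∑ m ∈ range (k + 2), legendreSym p m ≠ 0)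
      ⊆ (range (p - 2)) \ {1, p - 4} := by
    intro k hk
    rw [Finset.mem_filter] at hk
    rw [Finset.mem_sdiff, Finset.mem_insert, Finset.mem_singleton]
    refine ⟨hk.1, ?_⟩
    rintro (rfl | rfl)
    · exact hk.2 (sum_range_three_legendreSym_eq_zero p h2)
    · apply hk.2
      rw [show p - 4 + 2 = p - 2 by omega]
      exact sum_range_sub_two_legendreSym_eq_zero p h2 (by omega)
  have hcard := Finset.card_le_card hsub
  have hin : ({1, p - 4} : Finset ℕ) ⊆ range (p - 2) := by
    intro x hx
    rw [Finset.mem_insert, Finset.mem_singleton] at hx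
    rw [Finset.mem_range]; omega
  rw [Finset.card_sdiff_of_subset hin, Finset.card_range, Finset.card_pair (by omega)] at hcard
  omega

/-- **Peel with three forced zeros**: for every prime `p ≡ 5 (mod 8)` with `p ≥ 13` there is a splitting of `F_p`
with support-sum `≤ p - 3` (`S_p(2) = S_p((p-1)/2) = S_p(p-3) = 0`). -/
theorem peel_split_le_sub_three (h8 : p % 8 = 5) (hp13 : 13 ≤ p) : ∃ A B : ℂ[X],
    A * B = ∑ m ∈ Finset.range p, C ((legendreSym p m : ℤ) : ℂ) * X ^ m ∧
    A.support.card + B.support.card ≤ p - 3 := by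
  have hp2 : p ≠ 2 := by omega
  have h2 := legendreSym_two_eq_neg_one p (Or.inr h8)
  have hp4 : p % 4 = 1 := by omega
  obtain ⟨A, B, hAB, hA, hB⟩ := peel_split p hp2
  refine ⟨A, B, hAB, ?_⟩
  have hsub : (range (p - 2)).filter (fun k => ∑ m ∈ range (k + 2), legendreSym p m ≠ 0)
      ⊆ (range (p - 2)) \ {1, (p - 3) / 2, p - 4} := by
    intro k hk
    rw [Finset.mem_filter] at hk
    rw [Finset.mem_sdiff, Finset.mem_insert, Finset.mem_insert, Finset.mem_singleton]
    refine ⟨hk.1, ?_⟩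
    rintro (rfl | rfl | rfl)
    · exact hk.2 (sum_range_three_legendreSym_eq_zero p h2)
    · apply hk.2
      rw [show (p - 3) / 2 + 2 = (p + 1) / 2 by omega]
      exact sum_half_legendreSym_eq_zero p hp4
    · apply hk.2
      rw [show p - 4 + 2 = p - 2 by omega]
      exact sum_range_sub_two_legendreSym_eq_zero p h2 (by omega)
  have hcard := Finset.card_le_card hsub
  have hin : ({1, (p - 3) / 2, p - 4} : Finset ℕ) ⊆ range (p - 2) := by
    intro x hx
    rw [Finset.mem_insert, Finset.mem_insert, Finset.mem_singleton] at hx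
    rw [Finset.mem_range]; omega
  have h3 : ({1, (p - 3) / 2, p - 4} : Finset ℕ).card = 3 := by
    rw [Finset.card_insert_of_notMem, Finset.card_pair (by omega)]
    rw [Finset.mem_insert, Finset.mem_singleton]; omega
  rw [Finset.card_sdiff_of_subset hin, Finset.card_range, h3] at hcard
  omega

/-- **NATURAL STRENGTHENING REFUTED, eventual form sharpened**: even `∃ p₀ ∀ primes p ≥ p₀, every splitting has
support-sum ≥ p - 2` is FALSE — along the primes `p ≡ 5 (mod 8)` (Dirichlet, Mathlib) the peel has support-sum `≤ p - 3`.
(Cycle 1's `not_eventuallyTrivialOptimal` refuted `≥ p`; the true deficiency `p - min` is unbounded but `O(√p)` on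
average numerically, never an exponent.) -/
theorem not_eventually_ge_sub_two :
    ¬ ∃ p₀ : ℕ, ∀ (p : ℕ) [Fact p.Prime], p₀ ≤ p → ∀ (A B : ℂ[X]),
      A * B = ∑ m ∈ Finset.range p, C ((legendreSym p m : ℤ) : ℂ) * X ^ m →
        (p : ℝ) - 2 ≤ (A.support.card : ℝ) + (B.support.card : ℝ) := by
  rintro ⟨p₀, H⟩
  obtain ⟨q, hgt, hq, hmod⟩ := Nat.forall_exists_prime_gt_and_modEq (p₀ + 13) (q := 8) (a := 5) (by norm_num)
    (by norm_num)
  haveI : Fact q.Prime := ⟨hq⟩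
  have hq8 : q % 8 = 5 := by
    have := hmod; unfold Nat.ModEq at this; simpa using this
  obtain ⟨A, B, hAB, hle⟩ := peel_split_le_sub_three q hq8 (by omega)
  have h := H q (by omega) A B hAB
  have h' : ((A.support.card : ℝ) + (B.support.card : ℝ)) ≤ (q : ℝ) - 3 := by
    have hq3 : 3 ≤ q := by omega
    have : ((A.support.card + B.support.card : ℕ) : ℝ) ≤ ((q - 3 : ℕ) : ℝ) := by exact_mod_cast hle
    push_cast [Nat.cast_sub hq3] at this
    exact this
  linarith

end PeelDeficiency

/-! ## §B3  The peel deficiency is UNBOUNDED (cycle 4): for EVERY `K`, "`≥ p - K` eventually" is FALSE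
(landed as `Negative/UnboundedDeficiency.lean`, p84820)

Negative-side boundary fact (refuter-cdisprove-stmt-ValiantsHypothesis-3997-g4-0), PROVED, no new facts; removes every constant from
§B2.  MECHANISM — Legendre symbols imitating `χ₄`: by CRT + Dirichlet there are, beyond any bound, primes `p ≡ 5 (mod 8)` with
`p ≡ -1 (mod q)` for every odd prime `q ≤ N` (`exists_prime_five_mod_eight_and_neg_one_mod`); for them `(2|p) = -1` and, by
quadratic reciprocity (`p ≡ 1 (4)`), `(q|p) = (p|q) = (-1|q) = χ₄(q)` (`legendreSym_eq_chi4_of_neg_one_mod`), hence `(m|p) = χ₄(m)`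
for all odd `m ≤ N` (`legendreSym_eq_chi4_of_prime`); pairing `m = 2i+1, 2i+2` gives `S_p(2n) = Σ_{i<n} χ₄(2i+1) - S_p(n) =
[n odd] - S_p(n)` and `S_p(2) = 0`, so `S_p(2^j) = 0` for `1 ≤ j`, `2^j ≤ N` (`sum_legendreSym_two_pow_succ_eq_zero`;
`exists_prime_legendre_partial_sums_vanish`: a prime `p > n₀` with `S_p(2) = S_p(4) = ⋯ = S_p(2^{K+1}) = 0`).  With `N = 2^{K+1}` the
peel cofactor loses `K+1` coefficients: `not_eventually_ge_sub_const` — for every `K`,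
`¬ ∃ p₀ ∀ primes p ≥ p₀ ∀ A B, A·B = F_p → p - K ≤ |supp A| + |supp B|`.  So NO bound of the form `p - O(1)` holds; the primes
used are astronomically sparse (`p ≫ exp(2^K)`, deficiency `≈ log log p` there), while on average the deficiency is `≈ 1.28 √p`
(§B2 numerics) — the truth is `p - Θ(√p)` typically and provably not `p - O(1)`; the line's `(p+3)/2` and the crux are untouched.
-/

section UnboundedDeficiency

/-! ### 1. Partial sums of a `χ₄`-patterned Legendre symbol vanish at the powers of two -/

/-- Pairing a range sum of odd length: `Σ_{m ≤ 2n} g m = g 0 + Σ_{i<n} (g (2i+1) + g (2i+2))`. -/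
theorem sum_range_two_mul_add_one (g : ℕ → ℤ) (n : ℕ) :
    ∑ m ∈ range (2 * n + 1), g m = g 0 + ∑ i ∈ range n, (g (2 * i + 1) + g (2 * i + 2)) := by
  induction n with
  | zero => simp
  | succ n ih =>
    rw [show 2 * (n + 1) + 1 = 2 * n + 1 + 1 + 1 by ring, sum_range_succ, sum_range_succ, ih,
      sum_range_succ, show 2 * n + 1 + 1 = 2 * n + 2 by ring]
    ring

/-- `Σ_{i<2k} χ₄(2i+1) = 0` and `Σ_{i ≤ 2k} χ₄(2i+1) = 1` (the values alternate `1, -1, 1, -1, …`). -/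
theorem sum_range_chi4_odd (k : ℕ) :
    (∑ i ∈ range (2 * k), ZMod.χ₄ ((2 * i + 1 : ℕ) : ZMod 4)) = 0 ∧
    (∑ i ∈ range (2 * k + 1), ZMod.χ₄ ((2 * i + 1 : ℕ) : ZMod 4)) = 1 := by
  induction k with
  | zero => simp
  | succ k ih =>
    have hA : (∑ i ∈ range (2 * (k + 1)), ZMod.χ₄ ((2 * i + 1 : ℕ) : ZMod 4)) = 0 := by
      rw [show 2 * (k + 1) = 2 * k + 1 + 1 by ring, sum_range_succ, ih.2,
        ZMod.χ₄_nat_three_mod_four (by omega : (2 * (2 * k + 1) + 1) % 4 = 3)]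
      norm_num
    refine ⟨hA, ?_⟩
    rw [sum_range_succ, hA, ZMod.χ₄_nat_one_mod_four (by omega : (2 * (2 * (k + 1)) + 1) % 4 = 1)]
    norm_num

variable (p : ℕ) [Fact p.Prime]

/-- **Zeros at the powers of two.**  If `χ_p(2) = -1` and `χ_p(m) = χ₄(m)` for all odd `m ≤ N`, then
`S_p(2^{i+1}) = Σ_{m ≤ 2^{i+1}} (m|p) = 0` whenever `2^{i+1} ≤ N`.  (Induction: pairing `m = 2i'+1, 2i'+2` gives
`S_p(2n) = Σ_{i'<n} χ₄(2i'+1) - S_p(n)`, the first sum vanishes for even `n`, and `S_p(2) = 0 + 1 - 1 = 0`.) -/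
theorem sum_legendreSym_two_pow_succ_eq_zero (N : ℕ) (h2 : legendreSym p 2 = -1)
    (hodd : ∀ m : ℕ, m ≤ N → m % 2 = 1 → legendreSym p m = ZMod.χ₄ (m : ZMod 4)) :
    ∀ i : ℕ, 2 ^ (i + 1) ≤ N → ∑ m ∈ range (2 ^ (i + 1) + 1), legendreSym p m = 0 := by
  intro i
  induction i with
  | zero =>
    intro _
    exact sum_range_three_legendreSym_eq_zero p h2
  | succ i ih =>
    intro hN
    have hle : 2 ^ (i + 1) ≤ N := le_trans (Nat.pow_le_pow_right (by norm_num) (by omega)) hN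
    have ih' := ih hle
    -- `2^(i+2) = 2·n` with `n = 2^(i+1) = 2·2^i` even
    have hn2 : 2 ^ (i + 1 + 1) = 2 * 2 ^ (i + 1) := by ring
    rw [hn2, sum_range_two_mul_add_one]
    have hpair : ∀ i' ∈ range (2 ^ (i + 1)),
        legendreSym p ((2 * i' + 1 : ℕ) : ℤ) + legendreSym p ((2 * i' + 2 : ℕ) : ℤ) =
          ZMod.χ₄ ((2 * i' + 1 : ℕ) : ZMod 4) - legendreSym p ((i' + 1 : ℕ) : ℤ) := by
      intro i' hi'
      rw [mem_range] at hi'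
      rw [hodd (2 * i' + 1) (by omega) (by omega)]
      have hc : ((2 * i' + 2 : ℕ) : ℤ) = 2 * ((i' + 1 : ℕ) : ℤ) := by push_cast; ring
      rw [hc, legendreSym.mul, h2]
      ring
    rw [sum_congr rfl hpair, sum_sub_distrib]
    have hchi : (∑ i' ∈ range (2 ^ (i + 1)), ZMod.χ₄ ((2 * i' + 1 : ℕ) : ZMod 4)) = 0 := by
      rw [show 2 ^ (i + 1) = 2 * 2 ^ i by ring]
      exact (sum_range_chi4_odd (2 ^ i)).1
    have hshift : (∑ i' ∈ range (2 ^ (i + 1)), legendreSym p ((i' + 1 : ℕ) : ℤ)) = 0 := by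
      have h := Finset.sum_range_succ' (fun m : ℕ => legendreSym p (m : ℤ)) (2 ^ (i + 1))
      rw [ih'] at h
      simp only [Nat.cast_zero, legendreSym.at_zero, add_zero] at h
      exact h.symm
    rw [hchi, hshift]
    simp [legendreSym.at_zero]

/-! ### 2. From the primes to all odd `m ≤ N` (multiplicativity) -/

/-- If `(q|p) = χ₄(q)` for every odd prime `q ≤ N`, then `(m|p) = χ₄(m)` for every odd `m ≤ N`. -/
theorem legendreSym_eq_chi4_of_prime (N : ℕ)
    (hq : ∀ q : ℕ, q.Prime → q ≤ N → q % 2 = 1 → legendreSym p q = ZMod.χ₄ (q : ZMod 4)) :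
    ∀ m : ℕ, m ≤ N → m % 2 = 1 → legendreSym p m = ZMod.χ₄ (m : ZMod 4) := by
  intro m
  induction m using Nat.strong_induction_on with
  | _ m ih =>
    intro hmN hm2
    by_cases hm1 : m = 1
    · subst hm1
      simp [legendreSym.at_one]
    · obtain ⟨q, hqp, r, hr⟩ := Nat.exists_prime_and_dvd hm1
      have hq2 : q % 2 = 1 := by
        rcases Nat.mod_two_eq_zero_or_one q with h | h
        · exfalso
          have h2m : 2 ∣ m := dvd_trans (Nat.dvd_of_mod_eq_zero h) ⟨r, hr⟩
          omega
        · exact h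
      have hr2 : r % 2 = 1 := by
        rcases Nat.mod_two_eq_zero_or_one r with h | h
        · exfalso
          have h2m : 2 ∣ m := dvd_trans (Nat.dvd_of_mod_eq_zero h) ⟨q, by rw [hr]; ring⟩
          omega
        · exact h
      have hm0 : 0 < m := by omega
      have hqle : q ≤ m := Nat.le_of_dvd hm0 ⟨r, hr⟩
      have hrpos : 0 < r := by
        rcases Nat.eq_zero_or_pos r with h | h
        · rw [h, mul_zero] at hr; omega
        · exact h
      have hrlt : r < m := by
        rw [hr]
        have h2q : 2 ≤ q := hqp.two_le
        nlinarith
      rw [hr, Nat.cast_mul, legendreSym.mul, Nat.cast_mul, map_mul, hq q hqp (by omega) hq2,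
        ih r hrlt (by omega) hr2]

/-! ### 3. The primes: `p ≡ 5 (mod 8)`, `p ≡ -1 (mod q)` for all odd primes `q ≤ N` (CRT + Dirichlet) -/

/-- Beyond any bound there is a prime `p ≡ 5 (mod 8)` with `p ≡ -1 (mod q)` for every odd prime `q ≤ N`. -/
theorem exists_prime_five_mod_eight_and_neg_one_mod (N n₀ : ℕ) :
    ∃ p : ℕ, n₀ < p ∧ p.Prime ∧ p % 8 = 5 ∧ ∀ q : ℕ, q.Prime → q ≤ N → q % 2 = 1 → p % q = q - 1 := by
  classical
  set T : Finset ℕ := (range (N + 1)).filter (fun q => q.Prime ∧ q % 2 = 1) with hT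
  set D : ℕ := ∏ q ∈ T, q with hD
  have hTmem : ∀ q, q ∈ T ↔ q < N + 1 ∧ q.Prime ∧ q % 2 = 1 := fun q => by
    rw [hT, mem_filter, mem_range]
  have hDpos : 0 < D := prod_pos fun q hq => ((hTmem q).1 hq).2.1.pos
  have hDodd : D % 2 = 1 := by
    rw [hD, prod_nat_mod, prod_eq_one (fun q hq => ((hTmem q).1 hq).2.2)]
    norm_num
  have h2D : Nat.Coprime 2 D := (Nat.prime_two.coprime_iff_not_dvd).2 (by omega)
  have h8D : Nat.Coprime 8 D := by
    have h := Nat.Coprime.pow_left 3 h2D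
    norm_num at h
    exact h
  obtain ⟨k, hk8, hkD⟩ := Nat.chineseRemainder h8D 5 (D - 1)
  have hk5 : k % 8 = 5 := by
    have h := hk8
    unfold Nat.ModEq at h
    norm_num at h
    exact h
  have hkco : k.Coprime (8 * D) := by
    apply Nat.Coprime.mul_right
    · have h2 : Nat.Coprime k 2 := Nat.coprime_comm.1 ((Nat.prime_two.coprime_iff_not_dvd).2 (by omega))
      have h := Nat.Coprime.pow_right 3 h2
      norm_num at h
      exact h
    · have h1 : Nat.Coprime (D - 1) D :=
        (Nat.coprime_self_sub_left (by omega : 1 ≤ D)).2 (Nat.coprime_one_left D)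
      have hg := Nat.ModEq.gcd_eq hkD
      unfold Nat.Coprime at h1 ⊢
      rw [hg]
      exact h1
  obtain ⟨p, hpn, hpp, hpk⟩ :=
    Nat.forall_exists_prime_gt_and_modEq (n₀ + N) (q := 8 * D) (a := k) (by positivity) hkco
  refine ⟨p, by omega, hpp, ?_, ?_⟩
  · have h8 : p ≡ 5 [MOD 8] := (Nat.ModEq.of_mul_right D hpk).trans hk8
    unfold Nat.ModEq at h8
    norm_num at h8
    exact h8
  · intro q hq hqN hq2
    have hqT : q ∈ T := (hTmem q).2 ⟨by omega, hq, hq2⟩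
    have hqD : q ∣ D := dvd_prod_of_mem _ hqT
    have hmod : p ≡ D - 1 [MOD q] := Nat.ModEq.of_dvd hqD ((Nat.ModEq.of_mul_left 8 hpk).trans hkD)
    obtain ⟨e, he⟩ := hqD
    obtain ⟨e', rfl⟩ : ∃ e', e = e' + 1 := by
      rcases Nat.eq_zero_or_pos e with h | h
      · rw [h, mul_zero] at he; omega
      · exact ⟨e - 1, by omega⟩
    have hq1 : 1 ≤ q := hq.one_lt.le
    have hD1 : D - 1 = (q - 1) + q * e' := by
      rw [he, Nat.mul_succ]
      generalize q * e' = t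
      omega
    unfold Nat.ModEq at hmod
    rw [hD1, Nat.add_mul_mod_self_left, Nat.mod_eq_of_lt (by omega : q - 1 < q)] at hmod
    exact hmod

/-! ### 4. Reciprocity: for such `p`, `(q|p) = χ₄(q)` -/

/-- If `p ≡ 1 (mod 4)` and `p ≡ -1 (mod q)` for an odd prime `q`, then `(q|p) = (p|q) = (-1|q) = χ₄(q)`. -/
theorem legendreSym_eq_chi4_of_neg_one_mod {p : ℕ} [Fact p.Prime] (hp4 : p % 4 = 1) {q : ℕ} (hq : q.Prime)
    (hq2 : q % 2 = 1) (hpq : p % q = q - 1) : legendreSym p q = ZMod.χ₄ (q : ZMod 4) := by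
  haveI : Fact q.Prime := ⟨hq⟩
  have hq2' : q ≠ 2 := by rintro rfl; norm_num at hq2
  rw [← legendreSym.quadratic_reciprocity_one_mod_four hp4 hq2', legendreSym.mod q (p : ℤ)]
  have hmod : ((p : ℤ) % (q : ℤ)) = ((q - 1 : ℕ) : ℤ) := by
    rw [← Int.natCast_mod, hpq]
  rw [hmod, Literature.NumberTheory.LFunctions.legendreSym_natCast_sub q (le_of_lt hq.one_lt)]
  simp only [Nat.cast_one]
  exact legendreSym.at_neg_one hq2'

/-- **Positive by-product** (Legendre symbols only): for every `K` and every bound `n₀` there is a prime `p > n₀`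
(`p ≡ 5 (mod 8)`) whose partial sums vanish at `2, 4, 8, …, 2^{K+1}`: `S_p(2^{i+1}) = 0` for all `i ≤ K`. -/
theorem exists_prime_legendre_partial_sums_vanish (K n₀ : ℕ) :
    ∃ (p : ℕ) (_ : Fact p.Prime), n₀ < p ∧ p % 8 = 5 ∧
      ∀ i : ℕ, i ≤ K → ∑ m ∈ range (2 ^ (i + 1) + 1), legendreSym p m = 0 := by
  obtain ⟨p, hpgt, hpp, hp8, hpq⟩ := exists_prime_five_mod_eight_and_neg_one_mod (2 ^ (K + 1)) n₀
  haveI hF : Fact p.Prime := ⟨hpp⟩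
  have hp4 : p % 4 = 1 := by omega
  have h2 : legendreSym p 2 = -1 := legendreSym_two_eq_neg_one p (Or.inr hp8)
  have hpat := legendreSym_eq_chi4_of_prime p (2 ^ (K + 1))
    (fun q hq hqN hq2 => legendreSym_eq_chi4_of_neg_one_mod hp4 hq hq2 (hpq q hq hqN hq2))
  exact ⟨p, hF, hpgt, hp8, fun i hi =>
    sum_legendreSym_two_pow_succ_eq_zero p (2 ^ (K + 1)) h2 hpat i (Nat.pow_le_pow_right (by norm_num) (by omega))⟩

/-! ### 5. The refutation of every `p - K` bound -/

/-- **UNBOUNDED PEEL DEFICIENCY — natural strengthening refuted for every constant.**  For every `K : ℕ`,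
`∃ p₀ ∀ primes p ≥ p₀, every splitting A·B = F_p has |supp A| + |supp B| ≥ p - K` is FALSE: along the primes of
`exists_prime_legendre_partial_sums_vanish` the peel `(X - X²)·Σ_k S_p(k+1) X^k` has `≥ K+1` vanishing cofactor
coefficients, i.e. support-sum `≤ p - K - 1`.  (The crux's `p^{1/2+δ}` and the line's `(p+3)/2` are untouched; this
bounds from above what ANY method can certify uniformly in `p`: not `p - O(1)`.) -/
theorem not_eventually_ge_sub_const (K : ℕ) :
    ¬ ∃ p₀ : ℕ, ∀ (p : ℕ) [Fact p.Prime], p₀ ≤ p → ∀ (A B : ℂ[X]),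
      A * B = ∑ m ∈ Finset.range p, C ((legendreSym p m : ℤ) : ℂ) * X ^ m →
        (p : ℝ) - K ≤ (A.support.card : ℝ) + (B.support.card : ℝ) := by
  rintro ⟨p₀, H⟩
  obtain ⟨p, hF, hpgt, hp8, hzero⟩ := exists_prime_legendre_partial_sums_vanish K (p₀ + 2 ^ (K + 1) + 2)
  have hKlt : K + 1 < 2 ^ (K + 1) := Nat.lt_two_pow_self
  have hp2 : p ≠ 2 := by omega
  obtain ⟨A, B, hAB, hA, hB⟩ := peel_split p hp2
  have hle : A.support.card + B.support.card ≤ p - (K + 1) := by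
    classical
    set Z : Finset ℕ := (range (K + 1)).image (fun i => 2 ^ (i + 1) - 1) with hZ
    have hZcard : Z.card = K + 1 := by
      rw [hZ, card_image_of_injective _ ?_, card_range]
      intro i j hij
      have h1 : 0 < 2 ^ (i + 1) := by positivity
      have h2' : 0 < 2 ^ (j + 1) := by positivity
      have hij' : 2 ^ (i + 1) - 1 = 2 ^ (j + 1) - 1 := hij
      have heq : 2 ^ (i + 1) = 2 ^ (j + 1) := by omega
      have := Nat.pow_right_injective (le_refl 2) heq
      omega
    have hZsub : Z ⊆ range (p - 2) := by
      intro k hk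
      rw [hZ, mem_image] at hk
      obtain ⟨i, hi, rfl⟩ := hk
      rw [mem_range] at hi ⊢
      have : 2 ^ (i + 1) ≤ 2 ^ (K + 1) := Nat.pow_le_pow_right (by norm_num) (by omega)
      omega
    have hsub : (range (p - 2)).filter (fun k => ∑ m ∈ range (k + 2), legendreSym p m ≠ 0) ⊆
        range (p - 2) \ Z := by
      intro k hk
      rw [mem_filter] at hk
      rw [mem_sdiff]
      refine ⟨hk.1, fun hkZ => hk.2 ?_⟩
      rw [hZ, mem_image] at hkZ
      obtain ⟨i, hi, rfl⟩ := hkZ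
      rw [mem_range] at hi
      have h1 : 0 < 2 ^ (i + 1) := by positivity
      rw [show 2 ^ (i + 1) - 1 + 2 = 2 ^ (i + 1) + 1 by omega]
      exact hzero i (by omega)
    have hcard := card_le_card hsub
    rw [card_sdiff_of_subset hZsub, card_range, hZcard] at hcard
    rw [hA, hB]
    omega
  have h := H p (by omega) A B hAB
  have hKp : K + 1 ≤ p := by omega
  have h' : ((A.support.card : ℝ) + (B.support.card : ℝ)) ≤ (p : ℝ) - (K + 1) := by
    have : ((A.support.card + B.support.card : ℕ) : ℝ) ≤ ((p - (K + 1) : ℕ) : ℝ) := by exact_mod_cast hle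
    push_cast [Nat.cast_sub hKp] at this
    linarith
  linarith

end UnboundedDeficiency



/-! ## §F  The PLACE must lie over `p`, continued (cycle 3): even the SIGNED mod-3 shadow of the bound is false
(landed as `Negative/ModThreeShadow.lean`)

Negative-side load-bearing fact for the line `Cruxes/FeketeNoSparseSplit/Lines/cyclic-valuation-dichotomy.lean`
(refuter-cdisprove-stmt-ValiantsHypothesis-3997-g3-0), PROVED, no new facts; sharpens `Negative/ModTwoShadow.lean`
(cycle 2).  Modulo `2` the Legendre symbol is invisible (`±1 ≡ 1`), so the failure of the mod-2 shadow could be blamed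
on the loss of the signs.  Modulo `3` the signs SURVIVE (`1 ≢ -1`), yet the shadow of the line's bound still fails:
`fekete_nineteen_mod_three_split` — in `𝔽₃[X]`,
`F₁₉ ≡ (X + X⁴ - X⁹ - X¹²)·(1 - X - X² - X⁴ - X⁵ + X⁶)` (over `ℤ` the product is `F₁₉ + 3·(-X⁵ - X⁶ - X⁹ + X¹⁰ + X¹³ + X¹⁴)`),
support-sum `4 + 6 = 10 < 11 = (19+3)/2`, whereas every COMPLEX splitting of `F₁₉` has support-sum `≥ 15` (exhaustive,
item evidence) and the line proves `≥ 11` for all of them.  Hence `not_feketeModThreeShadowBound`.  Cycle-3 data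
(pure python, Cantor–Zassenhaus over `𝔽₃`, minimum over all `𝔽₃`-RATIONAL splittings = products of subsets of the
irreducible factors; `𝔽̄₃`-splittings can only be sparser): below `(p+3)/2` at
`p = 19, 23, 29, 31, 37, 43, 53, 59, 61, 67, 71, 73` (`10<11, 12<13, 13<16, 14<17, 19<20, 21<23, 27<28, 24<31, 30<32,
32<35, 35<37, 36<38`), not below at `p ≤ 17, 41, 47, 79`; over `𝔽₅` and `𝔽₇` no RATIONAL splitting goes below the
bound for `p ≤ 73` (untested over `𝔽̄₅`, `𝔽̄₇`).  So it is not the sign pattern of `χ_p` at some place that carries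
the line, but Euler's criterion `χ_p(m) ≡ m^{(p-1)/2} (mod p)` at the place over `p` itself — consistent with
`FalseWithoutLegendre` (values load-bearing) and `LeverCeiling` (the Legendre target is the lever's extremiser).
-/

/-- `19` is prime (local instance). -/
theorem fact_prime_nineteen : Fact (Nat.Prime 19) := ⟨by norm_num⟩

attribute [local instance] fact_prime_nineteen

/-- `F₁₉` reduced modulo `3`, explicitly (quadratic residues mod 19: `1,4,5,6,7,9,11,16,17`). -/
theorem fekete_nineteen_mod_three_eq :
    (∑ m ∈ Finset.range 19, C ((legendreSym 19 m : ℤ) : ZMod 3) * X ^ m) =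
      X - X ^ 2 - X ^ 3 + X ^ 4 + X ^ 5 + X ^ 6 + X ^ 7 - X ^ 8 + X ^ 9 - X ^ 10 + X ^ 11 - X ^ 12 - X ^ 13
        - X ^ 14 - X ^ 15 + X ^ 16 + X ^ 17 - X ^ 18 := by
  simp [Finset.sum_range_succ]
  norm_num
  ring

/-- The 4-term factor `X + X⁴ - X⁹ - X¹²` in injective-exponent form. -/
theorem A19_eq_sum : (X + X ^ 4 - X ^ 9 - X ^ 12 : (ZMod 3)[X]) =
    ∑ i : Fin 4, C ((![1, 1, -1, -1] : Fin 4 → ZMod 3) i) * X ^ ((![1, 4, 9, 12] : Fin 4 → ℕ) i) := by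
  simp [Fin.sum_univ_succ]
  ring

/-- `X + X⁴ - X⁹ - X¹²` has exactly four monomials over `𝔽₃`. -/
theorem card_support_A19 : ((X + X ^ 4 - X ^ 9 - X ^ 12 : (ZMod 3)[X])).support.card = 4 := by
  rw [A19_eq_sum]
  apply card_support_eq'
  · decide
  · intro i; fin_cases i <;> decide

/-- The 6-term factor `1 - X - X² - X⁴ - X⁵ + X⁶` in injective-exponent form. -/
theorem B19_eq_sum : (1 - X - X ^ 2 - X ^ 4 - X ^ 5 + X ^ 6 : (ZMod 3)[X]) =
    ∑ i : Fin 6, C ((![1, -1, -1, -1, -1, 1] : Fin 6 → ZMod 3) i) * X ^ ((![0, 1, 2, 4, 5, 6] : Fin 6 → ℕ) i) := by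
  simp [Fin.sum_univ_succ]
  ring

/-- `1 - X - X² - X⁴ - X⁵ + X⁶` has exactly six monomials over `𝔽₃`. -/
theorem card_support_B19 : ((1 - X - X ^ 2 - X ^ 4 - X ^ 5 + X ^ 6 : (ZMod 3)[X])).support.card = 6 := by
  rw [B19_eq_sum]
  apply card_support_eq'
  · decide
  · intro i; fin_cases i <;> decide

/-- **The mod-3 splitting at `p = 19`**: `F₁₉ ≡ (X + X⁴ - X⁹ - X¹²)·(1 - X - X² - X⁴ - X⁵ + X⁶) (mod 3)`,
support-sum `10 < 11 = (19+3)/2`.  (Over `ℤ` the product exceeds `F₁₉` by `3·(-X⁵ - X⁶ - X⁹ + X¹⁰ + X¹³ + X¹⁴)`.) -/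
theorem fekete_nineteen_mod_three_split : ∃ A B : (ZMod 3)[X],
    A * B = ∑ m ∈ Finset.range 19, C ((legendreSym 19 m : ℤ) : ZMod 3) * X ^ m ∧
    A.support.card + B.support.card = 10 := by
  refine ⟨X + X ^ 4 - X ^ 9 - X ^ 12, 1 - X - X ^ 2 - X ^ 4 - X ^ 5 + X ^ 6, ?_, ?_⟩
  · rw [fekete_nineteen_mod_three_eq]
    have h3 : (3 : (ZMod 3)[X]) = 0 := by exact_mod_cast CharP.cast_eq_zero (ZMod 3)[X] 3
    have key : (X + X ^ 4 - X ^ 9 - X ^ 12 : (ZMod 3)[X]) * (1 - X - X ^ 2 - X ^ 4 - X ^ 5 + X ^ 6) =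
        (X - X ^ 2 - X ^ 3 + X ^ 4 + X ^ 5 + X ^ 6 + X ^ 7 - X ^ 8 + X ^ 9 - X ^ 10 + X ^ 11 - X ^ 12 - X ^ 13
          - X ^ 14 - X ^ 15 + X ^ 16 + X ^ 17 - X ^ 18)
        + 3 * (-X ^ 5 - X ^ 6 - X ^ 9 + X ^ 10 + X ^ 13 + X ^ 14) := by
      ring
    rw [key, h3, zero_mul, add_zero]
  · rw [card_support_A19, card_support_B19]

/-- **The signed mod-3 shadow of the line's bound is FALSE** (so the place of reduction must lie over `p`, and not
because the signs are lost): it is not true that for every prime `p ≠ 2` every factorisation of `F_p mod 3` in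
`𝔽₃[X]` has support-sum `≥ (p+3)/2` (witness `p = 19`, support-sum `10`). -/
theorem not_feketeModThreeShadowBound :
    ¬ ∀ (p : ℕ) [Fact p.Prime], p ≠ 2 → ∀ A B : (ZMod 3)[X],
        A * B = ∑ m ∈ Finset.range p, C ((legendreSym p m : ℤ) : ZMod 3) * X ^ m →
        (p + 3) / 2 ≤ A.support.card + B.support.card := by
  intro H
  obtain ⟨A, B, h, hcard⟩ := fekete_nineteen_mod_three_split
  have := H 19 (by norm_num) A B h
  omega



/-! ## §G  The char-`p` lever: CEILING `(p-1)/2` for every unimodular target, attained EXACTLY at `±χ_p` (uniqueness, exact order = stub 2), the distance law, fragility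
(cycle 3; landed as `Negative/LeverCeiling.lean`; BarrierNotes-ideator2 §B1 as a theorem)

Negative-side boundary facts for the line `Cruxes/FeketeNoSparseSplit/Lines/cyclic-valuation-dichotomy.lean`
(refuter-cdisprove-stmt-ValiantsHypothesis-3997-g3-0; BarrierNotes-ideator2 §B1 "local-at-p ceiling ≈ p/2" made a
theorem, and sharpened), PROVED, no new facts.  The line certifies `|supp A| + |supp B| ≥ ord₁ Ā + ord₁ B̄ + 2 = ord₁ F̄_p + 2`
with `ord₁ F̄_p = (p-1)/2`.  This file shows the lever is tuned EXACTLY to the Legendre symbol, with zero slack: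

§1 CEILING (`section Ceiling`).
Negative-side boundary facts for the line `Cruxes/FeketeNoSparseSplit/Lines/cyclic-valuation-dichotomy.lean`
(refuter-cdisprove-stmt-ValiantsHypothesis-3997-g3-0; BarrierNotes-ideator2 §B1 "local-at-p ceiling ≈ p/2" made a
theorem), PROVED, no new facts.  The line certifies `|supp A| + |supp B| ≥ ord₁ Ā + ord₁ B̄ + 2 = ord₁ F̄_p + 2`
with `ord₁ F̄_p = (p-1)/2` (Euler's criterion).  Here:

* `not_pow_dvd_of_sum_sq_ne_zero` — for ANY coefficient sequence `ε` over a field of characteristic `p` with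
  `Σ_{m<p} ε(m)² ≠ 0`, `(X-1)^k ∤ E := Σ_{m<p} ε(m) X^m` as soon as `2k ≥ p`.  Proof: if `(X-1)^k ∣ E` then also
  `(X-1)^k ∣ E† := reflect (p-1) E`, so `X^p - 1 = (X-1)^p ∣ E·E†`; but `deg (E·E†) ≤ 2p-2` forces the cofactor to
  have degree `≤ p-2`, so the coefficient of `X^{p-1}` in `E·E†` vanishes — and it equals `Σ_m ε(m)²`.
* `rootMultiplicity_one_le_half` — hence `ord₁ E ≤ (p-1)/2` for every such `ε`; in particular for every `ε` with
  `ε(0) = 0` and `ε(m) = ±1` on `[1, p-1]` (`Σ ε² = p-1 = -1`, `rootMultiplicity_one_le_half_of_unimodular`), and for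
  `F̄_p` itself (`rootMultiplicity_one_fekete_le_half`: the `≤` half of the line's `stub_feketeModPOrder`, for free).
  So the multiplicity lever can NEVER certify more than `(p-1)/2 + 2 = (p+3)/2` for a `±1`-coefficient target on
  `[1, p-1]` — the line's constant `1/2` is the ceiling of the whole method, not an artefact of its execution; the
  Legendre symbol ATTAINS the ceiling, and `±χ_p` are the ONLY `±1` sequences attaining it
  (`Negative/LegendreExtremiser.lean`, `legendre_of_half_le_rootMultiplicity`: moments via `X·d/dX`, interpolation
  `P(x) = Σ ε(m)(1 - (x-m)^{p-1})` of degree `≤ (p-1)/2`, `P² = x^{p-1}`, `P = ±x^{(p-1)/2}` = Euler): the lever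
  characterises its target.
* `rootMultiplicity_one_flip_eq_zero` — FRAGILITY: flipping ONE sign of `F_p` (at any `1 ≤ m₀ < p`) gives a polynomial
  whose reduction has `ord₁ = 0` (its value at `1` is `∓2 ≠ 0`), so the certificate collapses from `(p+3)/2` to the
  trivial `2`, while the TRUE minimum support-sum of complex splittings is robust — exhaustively (cycle 3, pure python,
  Durand–Kerner, all `2^{p-3}` root subsets per flip): `p = 11`: all 10 one-flip perturbations have minimum `11` (every
  one of the 256 splittings full), `p = 13`: all 12 have minimum `13` (1024/1024 full), `p = 17`: all 16 have minimum `17` (16384/16384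
  full) — the flip even removes the `(X∓1)`-peel savings of `F_p` itself (`9`, `10`, `14`); `p = 7`: flips at `m₀ = 2,3,4,5` give `5` via the accidental factor
  `1 + X³` (`X - X² - X³ + X⁴ - X⁵ - X⁶ = (X + X⁴)(1 - X - X²)`).  Lesson for the sibling cruxes (`s₀ ≥ 3`, where this
  lever is void): the truth is sign-robust, the only known certificate is not.

§2 UNIQUENESS AND THE DISTANCE LAW (`section Extremiser`).
Negative-side boundary fact for the line `Cruxes/FeketeNoSparseSplit/Lines/cyclic-valuation-dichotomy.lean`
(refuter-cdisprove-stmt-ValiantsHypothesis-3997-g3-0), PROVED, no new facts; companion of `Negative/LeverCeiling.lean`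
(`ord₁ ≤ (p-1)/2` for every `±1` pattern).  `legendre_of_half_le_rootMultiplicity`: if `ε : [0,p) → {0, ±1} ⊂ 𝔽_p`,
`ε(0) = 0`, `ε(m) = ±1` for `1 ≤ m < p`, and `(X-1)^{(p-1)/2} ∣ Σ_{m<p} ε(m) X^m` in `𝔽_p[X]` (`p` odd), then
`ε = χ_p` or `ε = -χ_p` (pointwise, as elements of `𝔽_p`).  So among the `2^{p-1}` sign patterns the char-`p`
multiplicity lever reaches its ceiling `(p-1)/2` at EXACTLY two, `±χ_p`: the line's method applies to the Fekete
polynomial and to no other `±1`-polynomial on `[1, p-1]` — zero slack, which is also why one sign flip destroys the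
certificate (`LeverCeiling.rootMultiplicity_one_flip_eq_zero`) and why nothing of it survives for `s₀ ≥ 3` squares.
Proof (elementary, ~Euler): (1) `(X-1)^k ∣ E` forces the power moments `Σ_m ε(m) m^j = 0` for `j < k` (apply
`X·d/dX` repeatedly: each application costs one factor `X-1`, and `((X d/dX)^j E)(1) = Σ ε(m) m^j`); (2) the interpolating
polynomial `P(x) = Σ_m ε(m)(1 - (x-m)^{p-1})` has `P(m) = ε(m)` and coefficients `P_i = ∓ binom(p-1,i)·Σ_m ε(m) m^{p-1-i}`
(`i ≥ 1`), so the moments kill every `P_i` with `i > (p-1)/2`: `deg P ≤ (p-1)/2`; (3) `P² - x^{p-1}` has degree `≤ p-1`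
and vanishes on all of `𝔽_p` (`ε² = 1 = m^{p-1}` on units, `0` at `0`), hence is `0`; (4) `P² = (x^{(p-1)/2})²` in the
domain `𝔽_p[x]` gives `P = ±x^{(p-1)/2}`, i.e. `ε(m) = ±m^{(p-1)/2} = ±χ_p(m)` (Euler's criterion, `legendreSym.eq_pow`).
QUANTITATIVE FRAGILITY — the distance law `not_pow_dvd_of_close_to_legendre` (and `…_neg_legendre`): if an ARBITRARY
`ε : [0,p) → 𝔽_p` agrees with `χ_p` in `≥ p - k` positions but not in all, `1 ≤ k ≤ (p-1)/2`, then `(X-1)^k ∤ Σ ε(m) X^m`: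
after `k` arbitrary coefficient changes the multiplicity certificate of the line is `≤ k + 1` (it was `(p+3)/2`), whereas the
true minimum support-sum of the perturbed polynomial stays `≈ p` (exhaustively `= p` for every single sign flip at
`p = 11, 13, 17`, `LeverCeiling`).  Dictionary: `ord₁ = p - L` with `L` the `𝔽_p`-linear complexity of the `p`-periodic
sequence `ε` — the line's stub 2 is "`L(χ_p) = (p+1)/2`", the ceiling is "`L ≥ (p+1)/2` whenever `Σ ε² ≠ 0`", uniqueness
is "`±χ_p` are the only `(0,±1)` patterns of minimal complexity", and the distance law is the Aly–Winterhof `k`-error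
argument (Des. Codes Cryptogr. 40 (2006) 369–374, doi:10.1007/s10623-006-0023-5).

§3 EXACT ORDER (`section ExactOrder`): the ceiling is ATTAINED by the Legendre target — `half_pow_dvd_fekete(_zmod)`:
`(X-1)^{(p-1)/2} ∣ F̄_p` over every field of characteristic `p` (Euler: `F̄_p = (X·d/dX)^{(p-1)/2} (X-1)^{p-1}`, each
`X·d/dX` costs one factor `X-1`), hence `rootMultiplicity_one_fekete_eq_half`: `ord₁ F̄_p = (p-1)/2` EXACTLY — which is
the line's `stub_feketeModPOrder` (its `fekete K p` unfolds to this sum), obtained as the tightness statement of §1 and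
offered to the lead as a candidate proof.

§4 THE OTHER HALF (`section Fewnomial`): `charP_fewnomial` — a non-zero `g` of degree `< p` divisible by `(X-1)^m` in
characteristic `p` has `≥ m+1` monomials (moments + Vandermonde); this is the line's `stub_charPFewnomial` (candidate
proof for the lead; its tightness `stub_charPFewnomial_tight` landed in cycle 2).  §5 BOOKKEEPING (`section OrderDichotomy`):
`cyclic_order_dichotomy` — the line's `stub_cyclicOrderDichotomy` (candidate proof).  With §3–§5, stubs 1, 2, 3 of the
line are checked in this file (the whole char-`p` engine); what remains for the lead is the reduction at a place of `ℂ`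
over `p` (stub 4, `stub_primitiveReduction`).

Dictionary (sequences): `ord₁ E = p - L(ε)` with `L` the `𝔽_p`-linear complexity of the `p`-periodic sequence `ε`; §3 is
"`L(χ_p) = (p+1)/2`", §1 is "`L ≥ (p+1)/2` whenever `Σ ε² ≠ 0`", §2 is "`±χ_p` uniquely minimise `L` among `(0,±1)`
patterns" plus the Aly–Winterhof `k`-error argument (Des. Codes Cryptogr. 40 (2006) 369–374, doi:10.1007/s10623-006-0023-5).
-/

section Ceiling

variable {K : Type*} [Field K]

/-- `reflect 1 (X - 1) = 1 - X`. -/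
theorem reflect_one_X_sub_C_one : reflect 1 (X - C (1 : K)) = 1 - X := by
  have h : reflect 1 ((X : K[X]) ^ 1) = X ^ revAt 1 1 := reflect_monomial 1 1
  rw [pow_one, revAt_le (le_refl 1), Nat.sub_self, pow_zero] at h
  rw [reflect_sub, reflect_C, C_1, one_mul, pow_one, h]

/-- `reflect k ((X - 1)^k) = (1 - X)^k`. -/
theorem reflect_X_sub_C_one_pow (k : ℕ) : reflect k ((X - C (1 : K)) ^ k) = (1 - X) ^ k := by
  induction k with
  | zero => rw [pow_zero, pow_zero, ← C_1, reflect_C, C_1, one_mul, pow_zero]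
  | succ k ih =>
    have hdeg : ((X - C (1 : K)) ^ k).natDegree ≤ k := by
      rw [natDegree_pow, natDegree_X_sub_C, mul_one]
    rw [pow_succ, reflect_mul _ _ hdeg (natDegree_X_sub_C (1 : K)).le, ih, reflect_one_X_sub_C_one, pow_succ]

/-- Coefficients of an explicit sum of monomials `Σ_{i<p} ε(i) X^i`. -/
theorem coeff_sum_C_mul_X_pow (ε : ℕ → K) (p m : ℕ) :
    (∑ i ∈ range p, C (ε i) * X ^ i).coeff m = if m < p then ε m else 0 := by
  simp only [finsetSum_coeff, coeff_C_mul_X_pow]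
  rw [Finset.sum_ite_eq (range p) m]
  simp [Finset.mem_range]

/-- `Σ_{i<p} ε(i) X^i` has degree `≤ p - 1`. -/
theorem natDegree_sum_C_mul_X_pow_le (ε : ℕ → K) (p : ℕ) :
    (∑ i ∈ range p, C (ε i) * X ^ i).natDegree ≤ p - 1 := by
  refine natDegree_sum_le_of_forall_le _ _ fun i hi => ?_
  rw [Finset.mem_range] at hi
  exact (natDegree_C_mul_X_pow_le _ _).trans (by omega)

/-- If `Σ_{i<p} ε(i)² ≠ 0` then `Σ_{i<p} ε(i) X^i ≠ 0`. -/
theorem sum_C_mul_X_pow_ne_zero (ε : ℕ → K) (p : ℕ) (hε : (∑ m ∈ range p, ε m ^ 2) ≠ 0) :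
    (∑ i ∈ range p, C (ε i) * X ^ i) ≠ 0 := by
  intro h
  apply hε
  refine Finset.sum_eq_zero fun m hm => ?_
  rw [Finset.mem_range] at hm
  have hc := coeff_sum_C_mul_X_pow ε p m
  rw [h, coeff_zero, if_pos hm] at hc
  rw [← hc, sq, zero_mul]

/-- **The lever's ceiling (general form).**  Over a field `K` of characteristic `p`, if `Σ_{m<p} ε(m)² ≠ 0` then
`(X - 1)^k ∤ Σ_{m<p} ε(m) X^m` whenever `p ≤ 2k`.  (Reflect, multiply, reduce modulo `X^p - 1 = (X-1)^p`, read
off the coefficient of `X^{p-1}`, which is `Σ ε(m)²`.) [folklore] -/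
theorem not_pow_dvd_of_sum_sq_ne_zero (p : ℕ) [Fact p.Prime] [CharP K p] (ε : ℕ → K)
    (hε : (∑ m ∈ range p, ε m ^ 2) ≠ 0) {k : ℕ} (hk : p ≤ 2 * k) :
    ¬ (X - C (1 : K)) ^ k ∣ ∑ m ∈ range p, C (ε m) * X ^ m := by
  have hprime : p.Prime := Fact.out
  have hp1 : 1 ≤ p := hprime.one_lt.le
  set E : K[X] := ∑ m ∈ range p, C (ε m) * X ^ m with hE
  rintro ⟨G, hG⟩
  have hcoeff : ∀ m, E.coeff m = if m < p then ε m else 0 := coeff_sum_C_mul_X_pow ε p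
  have hE0 : E ≠ 0 := sum_C_mul_X_pow_ne_zero ε p hε
  have hdegE : E.natDegree ≤ p - 1 := natDegree_sum_C_mul_X_pow_le ε p
  have hXk0 : (X - C (1 : K)) ^ k ≠ 0 := pow_ne_zero _ (X_sub_C_ne_zero 1)
  have hdegXk : ((X - C (1 : K)) ^ k).natDegree = k := by
    rw [natDegree_pow, natDegree_X_sub_C, mul_one]
  have hG0 : G ≠ 0 := by
    rintro rfl
    rw [mul_zero] at hG
    exact hE0 hG
  have hdegG : k + G.natDegree ≤ p - 1 := by
    have h := natDegree_mul hXk0 hG0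
    rw [← hG, hdegXk] at h
    omega
  -- the reflected polynomial `E† = reflect (p-1) E` is again divisible by `(X-1)^k`
  set E' : K[X] := reflect (p - 1) E with hE'
  have hsplit : p - 1 = k + (p - 1 - k) := by omega
  have hrefl : E' = (1 - X) ^ k * reflect (p - 1 - k) G := by
    rw [hE', hG, show reflect (p - 1) ((X - C (1 : K)) ^ k * G) =
        reflect (k + (p - 1 - k)) ((X - C (1 : K)) ^ k * G) by rw [← hsplit],
      reflect_mul _ _ hdegXk.le (by omega), reflect_X_sub_C_one_pow]
  have hdvd' : (X - C (1 : K)) ^ k ∣ E' := by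
    rw [hrefl]
    refine Dvd.dvd.mul_right ⟨C (-1) ^ k, ?_⟩ _
    rw [← mul_pow]
    congr 1
    rw [map_neg, C_1]
    ring
  -- hence `(X-1)^p = X^p - 1` divides `E·E†`
  have h2k : (X - C (1 : K)) ^ (k + k) ∣ E * E' := by
    rw [pow_add]
    exact mul_dvd_mul ⟨G, hG⟩ hdvd'
  have hp_dvd : (X - C (1 : K)) ^ p ∣ E * E' := (pow_dvd_pow _ (by omega)).trans h2k
  rw [X_sub_C_one_pow_char K p] at hp_dvd
  obtain ⟨g, hg⟩ := hp_dvd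
  -- the coefficient of `X^{p-1}` in `E·E†` is `Σ ε(m)²`
  have hlhs : (E * E').coeff (p - 1) = ∑ m ∈ range p, ε m ^ 2 := by
    rw [coeff_mul, Finset.Nat.sum_antidiagonal_eq_sum_range_succ_mk, Nat.succ_eq_add_one,
      Nat.sub_add_cancel hp1]
    refine Finset.sum_congr rfl fun m hm => ?_
    rw [Finset.mem_range] at hm
    dsimp only
    rw [hE', coeff_reflect, revAt_le (by omega : p - 1 - m ≤ p - 1),
      show p - 1 - (p - 1 - m) = m by omega, hcoeff m, if_pos hm, sq]
  -- but in `(X^p - 1)·g` with `deg g ≤ p - 2` it vanishes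
  have hdegE' : E'.natDegree ≤ p - 1 := natDegree_reflect_le.trans (max_le le_rfl hdegE)
  have hdegEE' : (E * E').natDegree ≤ (p - 1) + (p - 1) := natDegree_mul_le.trans (add_le_add hdegE hdegE')
  have hXp0 : (X ^ p - 1 : K[X]) ≠ 0 := X_pow_sub_one_ne_zero' K p
  have hg0 : g ≠ 0 := by
    rintro rfl
    rw [mul_zero] at hg
    rw [hg, coeff_zero] at hlhs
    exact hε hlhs.symm
  have hdegg : g.natDegree + 1 ≤ p - 1 := by
    have h1 := natDegree_mul hXp0 hg0
    rw [← hg] at h1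
    have h2 : (X ^ p - 1 : K[X]).natDegree = p := by
      rw [← C_1, natDegree_X_pow_sub_C]
    rw [h2] at h1
    omega
  have hrhs : ((X ^ p - 1 : K[X]) * g).coeff (p - 1) = 0 := by
    rw [sub_mul, one_mul, coeff_sub, coeff_X_pow_mul', if_neg (by omega), zero_sub, neg_eq_zero]
    exact coeff_eq_zero_of_natDegree_lt (by omega)
  rw [hg, hrhs] at hlhs
  exact hε hlhs.symm

/-- **The lever's ceiling**: `ord₁ (Σ_{m<p} ε(m) X^m) ≤ (p-1)/2` whenever `Σ_{m<p} ε(m)² ≠ 0` (char `K = p`). -/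
theorem rootMultiplicity_one_le_half (p : ℕ) [Fact p.Prime] [CharP K p] (ε : ℕ → K)
    (hε : (∑ m ∈ range p, ε m ^ 2) ≠ 0) :
    rootMultiplicity (1 : K) (∑ m ∈ range p, C (ε m) * X ^ m) ≤ (p - 1) / 2 := by
  rw [rootMultiplicity_le_iff (sum_C_mul_X_pow_ne_zero ε p hε)]
  exact not_pow_dvd_of_sum_sq_ne_zero p ε hε (by omega)

/-- For `ε(0) = 0` and `ε(m)² = 1` on `[1, p-1]`: `Σ_{m<p} ε(m)² = -1` in characteristic `p`. -/
theorem sum_sq_eq_neg_one (p : ℕ) [Fact p.Prime] [CharP K p] (ε : ℕ → K) (h0 : ε 0 = 0)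
    (hε : ∀ m, 1 ≤ m → m < p → ε m ^ 2 = 1) : ∑ m ∈ range p, ε m ^ 2 = -1 := by
  have hprime : p.Prime := Fact.out
  obtain ⟨n, hn⟩ : ∃ n, p = n + 1 := ⟨p - 1, by have := hprime.one_lt; omega⟩
  have hsum : ∑ m ∈ range p, ε m ^ 2 = ∑ i ∈ range n, (1 : K) := by
    rw [hn, Finset.sum_range_succ', h0, sq, zero_mul, add_zero]
    exact Finset.sum_congr rfl fun i hi => hε (i + 1) (by omega) (by rw [Finset.mem_range] at hi; omega)
  rw [hsum, Finset.sum_const, Finset.card_range, nsmul_eq_mul, mul_one]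
  have hp0 : ((p : ℕ) : K) = 0 := CharP.cast_eq_zero K p
  rw [hn, Nat.cast_succ] at hp0
  exact eq_neg_of_add_eq_zero_left hp0

/-- **Ceiling for unimodular targets**: for every `ε` with `ε(0) = 0`, `ε(m) = ±1` (`1 ≤ m < p`) — every conceivable
`±1` "symbol" on `[1, p-1]`, Legendre or not — the multiplicity of `1` as a root of `Σ_{m<p} ε(m) X^m` over a field
of characteristic `p` is at most `(p-1)/2`.  The char-`p` multiplicity lever therefore certifies at most
`(p-1)/2 + 2 = (p+3)/2`: the line's constant is the METHOD's ceiling (BarrierNotes-ideator2 §B1 as a theorem). -/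
theorem rootMultiplicity_one_le_half_of_unimodular (p : ℕ) [Fact p.Prime] [CharP K p] (ε : ℕ → K)
    (h0 : ε 0 = 0) (hε : ∀ m, 1 ≤ m → m < p → ε m = 1 ∨ ε m = -1) :
    rootMultiplicity (1 : K) (∑ m ∈ range p, C (ε m) * X ^ m) ≤ (p - 1) / 2 := by
  refine rootMultiplicity_one_le_half p ε ?_
  rw [sum_sq_eq_neg_one p ε h0 fun m h1 h2 => ?_]
  · exact neg_ne_zero.mpr one_ne_zero
  · rcases hε m h1 h2 with h | h <;> rw [h] <;> ring

/-- **The Legendre target sits exactly at the ceiling** (`≤` half of the line's `stub_feketeModPOrder`, for free):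
`ord₁ F̄_p ≤ (p-1)/2` over every field of characteristic `p`. -/
theorem rootMultiplicity_one_fekete_le_half (p : ℕ) [Fact p.Prime] [CharP K p] :
    rootMultiplicity (1 : K) (∑ m ∈ Finset.range p, C ((legendreSym p m : ℤ) : K) * X ^ m) ≤ (p - 1) / 2 := by
  refine rootMultiplicity_one_le_half_of_unimodular p (fun m => ((legendreSym p m : ℤ) : K)) ?_ ?_
  · simp [legendreSym.at_zero]
  · intro m h1 h2
    have hne : ((((m : ℕ) : ℤ)) : ZMod p) ≠ 0 := by
      rw [Int.cast_natCast, Ne, ZMod.natCast_eq_zero_iff]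
      exact Nat.not_dvd_of_pos_of_lt (by omega) h2
    rcases legendreSym.eq_one_or_neg_one p hne with h | h
    · left; simp [h]
    · right; simp [h]

/-- **Fragility of the certificate**: flip ONE sign of `F_p` — at any position `1 ≤ m₀ < p` — and the reduction
modulo `p` no longer vanishes at `1` at all (`ord₁ = 0`: the value at `1` is `Σ χ_p - 2χ_p(m₀) = ∓2 ≠ 0`, `p` odd).
The lever's bound drops from `(p+3)/2` to the trivial `2`; the true minimum support-sum does not drop (exhaustive
numerics in the module docstring: it rises to `p` at `p = 11, 13, 17`). -/
theorem rootMultiplicity_one_flip_eq_zero (p : ℕ) [Fact p.Prime] [CharP K p] (hp : p ≠ 2)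
    (m₀ : ℕ) (hm₀ : 1 ≤ m₀) (hm₀p : m₀ < p) :
    rootMultiplicity (1 : K) (∑ m ∈ Finset.range p, C ((legendreSym p m : ℤ) : K) * X ^ m
      - C (2 * ((legendreSym p m₀ : ℤ) : K)) * X ^ m₀) = 0 := by
  have hprime : p.Prime := Fact.out
  rw [rootMultiplicity_eq_zero_iff]
  intro hroot
  exfalso
  have hev : (∑ m ∈ Finset.range p, C ((legendreSym p m : ℤ) : K) * X ^ m).eval 1 = 0 := by
    rw [eval_finsetSum]
    simp only [eval_mul, eval_C, eval_pow, eval_X, one_pow, mul_one]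
    rw [← Int.cast_sum, Literature.NumberTheory.LFunctions.sum_range_legendreSym p hp, Int.cast_zero]
  rw [IsRoot, eval_sub, hev, eval_mul, eval_C, eval_pow, eval_X, one_pow, mul_one, zero_sub, neg_eq_zero,
    mul_eq_zero] at hroot
  have h2 : (2 : K) ≠ 0 := by
    intro h
    have h' : ((2 : ℕ) : K) = 0 := by exact_mod_cast h
    rw [CharP.cast_eq_zero_iff K p] at h'
    have := (Nat.prime_dvd_prime_iff_eq hprime Nat.prime_two).mp h'
    exact hp this
  have hne : ((((m₀ : ℕ) : ℤ)) : ZMod p) ≠ 0 := by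
    rw [Int.cast_natCast, Ne, ZMod.natCast_eq_zero_iff]
    exact Nat.not_dvd_of_pos_of_lt (by omega) hm₀p
  rcases hroot with h | h
  · exact h2 h
  · rcases legendreSym.eq_one_or_neg_one p hne with h1 | h1
    · rw [h1, Int.cast_one] at h; exact one_ne_zero h
    · rw [h1, Int.cast_neg, Int.cast_one, neg_eq_zero] at h; exact one_ne_zero h


end Ceiling

section Extremiser

variable {R : Type*} [CommRing R]

/-- The Euler operator `X·d/dX` on a monomial sum multiplies the `m`-th coefficient by `m`. -/
theorem X_mul_derivative_sum_C_mul_X_pow (c : ℕ → R) (n : ℕ) :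
    X * derivative (∑ m ∈ range n, C (c m) * X ^ m) = ∑ m ∈ range n, C (c m * m) * X ^ m := by
  rw [derivative_sum, Finset.mul_sum]
  refine Finset.sum_congr rfl fun m _ => ?_
  rw [derivative_C_mul_X_pow]
  cases m with
  | zero => simp
  | succ k =>
    rw [Nat.add_sub_cancel, pow_succ]
    push_cast
    ring

/-- Iterating `X·d/dX` `j` times multiplies the `m`-th coefficient by `m^j`. -/
theorem iterate_X_mul_derivative_sum_C_mul_X_pow (c : ℕ → R) (n j : ℕ) :
    (fun F : R[X] => X * derivative F)^[j] (∑ m ∈ range n, C (c m) * X ^ m) =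
      ∑ m ∈ range n, C (c m * (m : R) ^ j) * X ^ m := by
  induction j with
  | zero => simp
  | succ j ih =>
    rw [Function.iterate_succ_apply', ih, X_mul_derivative_sum_C_mul_X_pow]
    refine Finset.sum_congr rfl fun m _ => ?_
    rw [pow_succ, mul_assoc]

/-- One application of `X·d/dX` costs at most one factor `X - 1`. -/
theorem X_sub_C_pow_dvd_X_mul_derivative (F : R[X]) (k : ℕ) (h : (X - C (1 : R)) ^ (k + 1) ∣ F) :
    (X - C (1 : R)) ^ k ∣ X * derivative F := by
  obtain ⟨G, rfl⟩ := h
  rw [derivative_mul, derivative_pow, derivative_X_sub_C, mul_one, Nat.add_sub_cancel]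
  refine Dvd.dvd.mul_left (dvd_add ?_ ?_) _
  · exact ⟨C ((k + 1 : ℕ) : R) * G, by ring⟩
  · rw [pow_succ]
    exact ⟨(X - C (1 : R)) * derivative G, by ring⟩

/-- `(X-1)^k ∣ F` implies `(X-1)^{k-j} ∣ (X·d/dX)^j F` for `j ≤ k`. -/
theorem X_sub_C_pow_dvd_iterate (F : R[X]) (k : ℕ) (h : (X - C (1 : R)) ^ k ∣ F) :
    ∀ j, j ≤ k → (X - C (1 : R)) ^ (k - j) ∣ (fun F : R[X] => X * derivative F)^[j] F := by
  intro j
  induction j with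
  | zero => intro _; simpa using h
  | succ j ih =>
    intro hj
    rw [Function.iterate_succ_apply']
    refine X_sub_C_pow_dvd_X_mul_derivative _ _ ?_
    have := ih (by omega)
    rwa [show k - j = k - (j + 1) + 1 by omega] at this

/-- **Moment vanishing**: `(X-1)^k ∣ Σ_{m<n} c(m) X^m` forces `Σ_{m<n} c(m)·m^j = 0` for every `j < k`. [folklore] -/
theorem sum_mul_pow_eq_zero_of_pow_dvd (c : ℕ → R) (n k : ℕ)
    (h : (X - C (1 : R)) ^ k ∣ ∑ m ∈ range n, C (c m) * X ^ m) (j : ℕ) (hj : j < k) :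
    ∑ m ∈ range n, c m * (m : R) ^ j = 0 := by
  have hdvd := X_sub_C_pow_dvd_iterate _ k h j hj.le
  rw [iterate_X_mul_derivative_sum_C_mul_X_pow] at hdvd
  have h1 : (X - C (1 : R)) ∣ ∑ m ∈ range n, C (c m * (m : R) ^ j) * X ^ m :=
    (dvd_pow_self _ (by omega : k - j ≠ 0)).trans hdvd
  rw [dvd_iff_isRoot, IsRoot, eval_finsetSum] at h1
  simpa [eval_mul, eval_C, eval_pow, eval_X] using h1

variable (p : ℕ) [Fact p.Prime]

/-- The interpolating polynomial `P(x) = Σ_{m<p} ε(m)·(1 - (x - m)^{p-1})` of a function `ε` on `𝔽_p` satisfies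
`P(m') = ε(m')` for `m' < p` (Fermat: `(m' - m)^{p-1} = [m ≠ m']`). -/
theorem eval_interp (ε : ℕ → ZMod p) (m' : ℕ) (hm' : m' < p) :
    (∑ m ∈ range p, C (ε m) * (1 - (X - C (m : ZMod p)) ^ (p - 1))).eval (m' : ZMod p) = ε m' := by
  have hprime : p.Prime := Fact.out
  rw [eval_finsetSum, Finset.sum_eq_single m']
  · have hp1 : p - 1 ≠ 0 := by have := hprime.two_le; omega
    simp [eval_mul, eval_C, eval_sub, eval_one, eval_pow, eval_X, zero_pow hp1]
  · intro m hm hne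
    rw [Finset.mem_range] at hm
    have hne' : ((m' : ZMod p) - (m : ZMod p)) ≠ 0 := by
      intro h
      rw [sub_eq_zero, ZMod.natCast_eq_natCast_iff', Nat.mod_eq_of_lt hm', Nat.mod_eq_of_lt hm] at h
      exact hne h.symm
    simp [eval_mul, eval_C, eval_sub, eval_one, eval_pow, eval_X, ZMod.pow_card_sub_one_eq_one hne']
  · intro h
    exact absurd (Finset.mem_range.mpr hm') h

/-- The coefficients of `P` above degree `0` are signed binomial multiples of the power moments:
`P_i = -binom(p-1, i)·(-1)^{p-1-i}·Σ_m ε(m) m^{p-1-i}` for `i ≥ 1`. -/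
theorem coeff_interp (ε : ℕ → ZMod p) (i : ℕ) (hi : 1 ≤ i) :
    (∑ m ∈ range p, C (ε m) * (1 - (X - C (m : ZMod p)) ^ (p - 1))).coeff i =
      -(((p - 1).choose i : ZMod p) * (-1) ^ (p - 1 - i)) * ∑ m ∈ range p, ε m * (m : ZMod p) ^ (p - 1 - i) := by
  rw [finsetSum_coeff, Finset.mul_sum]
  refine Finset.sum_congr rfl fun m _ => ?_
  rw [mul_sub, mul_one, coeff_sub, coeff_C, if_neg (by omega), zero_sub, coeff_C_mul,
    show (X - C (m : ZMod p)) = X + C (-(m : ZMod p)) by rw [map_neg, sub_eq_add_neg], coeff_X_add_C_pow, neg_pow]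
  ring

/-- If the power moments `Σ ε(m) m^j` vanish for all `j < h`, where `p - 1 ≤ 2h`, then `deg P ≤ h`. -/
theorem natDegree_interp_le (ε : ℕ → ZMod p) (h : ℕ) (h2 : p - 1 ≤ 2 * h) (h1 : 1 ≤ h)
    (hmom : ∀ j, j < h → ∑ m ∈ range p, ε m * (m : ZMod p) ^ j = 0) :
    (∑ m ∈ range p, C (ε m) * (1 - (X - C (m : ZMod p)) ^ (p - 1))).natDegree ≤ h := by
  rw [natDegree_le_iff_coeff_eq_zero]
  intro i hi
  have hi' : h < i := by exact_mod_cast hi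
  rw [coeff_interp p ε i (by omega), hmom (p - 1 - i) (by omega), mul_zero]

/-- **The lever characterises the Legendre symbol.**  For an odd prime `p` and `ε : ℕ → 𝔽_p` with `ε(0) = 0` and
`ε(m) = ±1` for `1 ≤ m < p`: if `(X - 1)^{(p-1)/2}` divides `Σ_{m<p} ε(m) X^m` in `𝔽_p[X]`, then `ε = χ_p` on `[0, p)`
or `ε = -χ_p` on `[0, p)`.  With `LeverCeiling.rootMultiplicity_one_le_half_of_unimodular` (order `≤ (p-1)/2` always):
the multiplicity lever attains its ceiling at exactly the two patterns `±χ_p`. [folklore] -/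
theorem legendre_of_half_le_rootMultiplicity (hp : p ≠ 2) (ε : ℕ → ZMod p) (h0 : ε 0 = 0)
    (hε : ∀ m, 1 ≤ m → m < p → ε m = 1 ∨ ε m = -1)
    (hdvd : (X - C (1 : ZMod p)) ^ ((p - 1) / 2) ∣ ∑ m ∈ range p, C (ε m) * X ^ m) :
    (∀ m, m < p → ε m = (legendreSym p m : ZMod p)) ∨ (∀ m, m < p → ε m = -(legendreSym p m : ZMod p)) := by
  have hprime : p.Prime := Fact.out
  obtain ⟨h, hh⟩ : ∃ h, p = 2 * h + 1 := hprime.eq_two_or_odd'.resolve_left hp |>.imp fun h hh => by omega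
  have hhalf : (p - 1) / 2 = h := by omega
  have hdiv2 : p / 2 = h := by omega
  have h1 : 1 ≤ h := by
    rcases Nat.lt_or_ge h 1 with hlt | hge
    · exfalso; have : p = 1 := by omega
      exact hprime.one_lt.ne' this
    · exact hge
  rw [hhalf] at hdvd
  -- (1) moments vanish below h
  have hmom : ∀ j, j < h → ∑ m ∈ range p, ε m * (m : ZMod p) ^ j = 0 :=
    fun j hj => sum_mul_pow_eq_zero_of_pow_dvd ε p h hdvd j hj
  -- (2) the interpolant has degree ≤ h
  set P : (ZMod p)[X] := (∑ m ∈ range p, C (ε m) * (1 - (X - C (m : ZMod p)) ^ (p - 1))) with hP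
  have hdegP : P.natDegree ≤ h := natDegree_interp_le p ε h (by omega) h1 hmom
  -- (3) P² - X^{p-1} vanishes identically
  have hQ : P ^ 2 - X ^ (p - 1) = 0 := by
    refine eq_zero_of_natDegree_lt_card_of_eval_eq_zero _ (f := (id : ZMod p → ZMod p))
      Function.injective_id ?_ ?_
    · intro x
      have hx : x = ((x.val : ℕ) : ZMod p) := (ZMod.natCast_zmod_val x).symm
      have hxlt : x.val < p := x.val_lt
      rw [id, eval_sub, eval_pow, eval_pow, eval_X, hx, eval_interp p ε _ hxlt]
      by_cases hx0 : x.val = 0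
      · rw [hx0, h0, Nat.cast_zero, zero_pow two_ne_zero, zero_pow (by omega), sub_zero]
      · have hne : ((x.val : ℕ) : ZMod p) ≠ 0 := by
          rw [Ne, ZMod.natCast_eq_zero_iff]; exact Nat.not_dvd_of_pos_of_lt (by omega) hxlt
        rw [ZMod.pow_card_sub_one_eq_one hne]
        rcases hε x.val (by omega) hxlt with h' | h' <;> rw [h'] <;> ring
    · have hdeg2 : (P ^ 2).natDegree ≤ p - 1 := natDegree_pow_le.trans (by omega)
      have hdegX : ((X : (ZMod p)[X]) ^ (p - 1)).natDegree ≤ p - 1 := (natDegree_X_pow _).le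
      have := natDegree_sub_le_of_le hdeg2 hdegX
      rw [ZMod.card]
      omega
  -- (4) P = ± X^h
  have hsq : P ^ 2 = (X ^ h) ^ 2 := by
    rw [← pow_mul, show h * 2 = p - 1 by omega]; exact sub_eq_zero.mp hQ
  have heuler : ∀ m : ℕ, (legendreSym p m : ZMod p) = (m : ZMod p) ^ h := by
    intro m
    rw [legendreSym.eq_pow, hdiv2, Int.cast_natCast]
  rcases sq_eq_sq_iff_eq_or_eq_neg.mp hsq with hPX | hPX
  · left
    intro m hm
    rw [← eval_interp p ε m hm, ← hP, hPX, eval_pow, eval_X, heuler]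
  · right
    intro m hm
    rw [← eval_interp p ε m hm, ← hP, hPX, eval_neg, eval_pow, eval_X, heuler]

/-- **Strictness away from `±χ_p`**: a `±1` pattern on `[1, p-1]` (with `ε(0) = 0`) that differs from `χ_p` somewhere
and from `-χ_p` somewhere has `(X-1)^{(p-1)/2} ∤ Σ ε(m) X^m`, i.e. order at `1` STRICTLY below the Legendre value
`(p-1)/2` — the certificate `ord₁ + 2` of the line is then `< (p+3)/2`. -/
theorem not_half_dvd_of_ne_legendre (hp : p ≠ 2) (ε : ℕ → ZMod p) (h0 : ε 0 = 0)
    (hε : ∀ m, 1 ≤ m → m < p → ε m = 1 ∨ ε m = -1)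
    (m₁ : ℕ) (hm₁ : m₁ < p) (hne₁ : ε m₁ ≠ (legendreSym p m₁ : ZMod p))
    (m₂ : ℕ) (hm₂ : m₂ < p) (hne₂ : ε m₂ ≠ -(legendreSym p m₂ : ZMod p)) :
    ¬ (X - C (1 : ZMod p)) ^ ((p - 1) / 2) ∣ ∑ m ∈ range p, C (ε m) * X ^ m := by
  intro hdvd
  rcases legendre_of_half_le_rootMultiplicity p hp ε h0 hε hdvd with H | H
  · exact hne₁ (H m₁ hm₁)
  · exact hne₂ (H m₂ hm₂)

/-- General degree bound: if the power moments `Σ ε(m) m^j` vanish for all `j < L` (`L ≥ 1`), then `deg P ≤ p - 1 - L`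
— the dictionary "`ord₁ ≥ L` ⟹ `ε` is a polynomial function on `𝔽_p` of degree `≤ p - 1 - L`" (equivalently: the
`𝔽_p`-linear complexity of the `p`-periodic sequence `ε` is `p - ord₁`; cf. Aly–Winterhof, Des. Codes Cryptogr. 40
(2006), doi:10.1007/s10623-006-0023-5, for the Legendre sequence). -/
theorem natDegree_interp_le_sub (ε : ℕ → ZMod p) (L : ℕ) (hL : 1 ≤ L)
    (hmom : ∀ j, j < L → ∑ m ∈ range p, ε m * (m : ZMod p) ^ j = 0) :
    (∑ m ∈ range p, C (ε m) * (1 - (X - C (m : ZMod p)) ^ (p - 1))).natDegree ≤ p - 1 - L := by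
  rw [natDegree_le_iff_coeff_eq_zero]
  intro i hi
  have hi' : p - 1 - L < i := by exact_mod_cast hi
  rw [coeff_interp p ε i (by omega), hmom (p - 1 - i) (by omega), mul_zero]

/-- **The distance law (quantitative fragility of the certificate).**  Let `ε : [0, p) → 𝔽_p` be ANY coefficient
sequence (no `±1` hypothesis) that agrees with `χ_p` at `≥ p - k` of the `p` positions but not everywhere, where
`1 ≤ k ≤ (p-1)/2`.  Then `(X-1)^k ∤ Σ_{m<p} ε(m) X^m` in `𝔽_p[X]`: after `k` arbitrary changes to the coefficients of
`F_p` the char-`p` multiplicity certificate is at most `(k-1) + 2 = k + 1`.  (`k = 1`: one changed coefficient ⟹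
`ord₁ = 0`, cf. `LeverCeiling.rootMultiplicity_one_flip_eq_zero`; the Aly–Winterhof `k`-error argument: `ord₁ ≥ k`
makes `ε` a polynomial function of degree `≤ p-1-k`, which then agrees with the degree-`(p-1)/2` function `m^{(p-1)/2}`
at `≥ p-k > p-1-k` points, so they coincide.) [folklore] -/
theorem not_pow_dvd_of_close_to_legendre (hp : p ≠ 2) (ε : ℕ → ZMod p) (k : ℕ) (hk1 : 1 ≤ k)
    (hk : k ≤ (p - 1) / 2)
    (hclose : p - k ≤ ((range p).filter (fun m => ε m = (legendreSym p m : ZMod p))).card)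
    (m₁ : ℕ) (hm₁ : m₁ < p) (hne : ε m₁ ≠ (legendreSym p m₁ : ZMod p)) :
    ¬ (X - C (1 : ZMod p)) ^ k ∣ ∑ m ∈ range p, C (ε m) * X ^ m := by
  have hprime : p.Prime := Fact.out
  obtain ⟨h, hh⟩ : ∃ h, p = 2 * h + 1 := hprime.eq_two_or_odd'.resolve_left hp |>.imp fun h hh => by omega
  have hdiv2 : p / 2 = h := by omega
  have heuler : ∀ m : ℕ, (legendreSym p m : ZMod p) = (m : ZMod p) ^ h := by
    intro m
    rw [legendreSym.eq_pow, hdiv2, Int.cast_natCast]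
  intro hdvd
  -- moments vanish below k, so the interpolant has degree ≤ p - 1 - k
  have hmom : ∀ j, j < k → ∑ m ∈ range p, ε m * (m : ZMod p) ^ j = 0 :=
    fun j hj => sum_mul_pow_eq_zero_of_pow_dvd ε p k hdvd j hj
  set P : (ZMod p)[X] := (∑ m ∈ range p, C (ε m) * (1 - (X - C (m : ZMod p)) ^ (p - 1))) with hP
  have hdegP : P.natDegree ≤ p - 1 - k := natDegree_interp_le_sub p ε k hk1 hmom
  -- R := P - X^h vanishes wherever ε agrees with χ_p
  set R : (ZMod p)[X] := P - X ^ h with hR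
  have hdegR : R.natDegree ≤ p - 1 - k := by
    have hX : ((X : (ZMod p)[X]) ^ h).natDegree ≤ p - 1 - k := by
      rw [natDegree_X_pow]; omega
    exact (natDegree_sub_le_of_le hdegP hX).trans (max_le le_rfl le_rfl)
  set S := (range p).filter (fun m => ε m = (legendreSym p m : ZMod p)) with hS
  have hinj : Set.InjOn (fun m : ℕ => (m : ZMod p)) (S : Set ℕ) := by
    intro a ha b hb hab
    have ha' : a < p := by
      have : a ∈ S := ha
      rw [hS, Finset.mem_filter, Finset.mem_range] at this; exact this.1
    have hb' : b < p := by
      have : b ∈ S := hb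
      rw [hS, Finset.mem_filter, Finset.mem_range] at this; exact this.1
    have := hab
    simp only at this
    rw [ZMod.natCast_eq_natCast_iff', Nat.mod_eq_of_lt ha', Nat.mod_eq_of_lt hb'] at this
    exact this
  have hR0 : R = 0 := by
    refine eq_zero_of_natDegree_lt_card_of_eval_eq_zero' R (S.image fun m : ℕ => (m : ZMod p)) ?_ ?_
    · intro x hx
      rw [Finset.mem_image] at hx
      obtain ⟨m, hm, rfl⟩ := hx
      rw [hS, Finset.mem_filter, Finset.mem_range] at hm
      rw [hR, eval_sub, eval_pow, eval_X, hP, eval_interp p ε m hm.1, hm.2, heuler, sub_self]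
    · rw [Finset.card_image_of_injOn hinj]
      omega
  -- hence P = X^h and ε agrees with χ_p everywhere, contradicting m₁
  have hPX : P = X ^ h := sub_eq_zero.mp hR0
  apply hne
  rw [← eval_interp p ε m₁ hm₁, ← hP, hPX, eval_pow, eval_X, heuler]

/-- The distance law towards `-χ_p` (apply the previous theorem to `-ε`). -/
theorem not_pow_dvd_of_close_to_neg_legendre (hp : p ≠ 2) (ε : ℕ → ZMod p) (k : ℕ) (hk1 : 1 ≤ k)
    (hk : k ≤ (p - 1) / 2)
    (hclose : p - k ≤ ((range p).filter (fun m => ε m = -(legendreSym p m : ZMod p))).card)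
    (m₁ : ℕ) (hm₁ : m₁ < p) (hne : ε m₁ ≠ -(legendreSym p m₁ : ZMod p)) :
    ¬ (X - C (1 : ZMod p)) ^ k ∣ ∑ m ∈ range p, C (ε m) * X ^ m := by
  intro hdvd
  refine not_pow_dvd_of_close_to_legendre p hp (fun m => -ε m) k hk1 hk ?_ m₁ hm₁ ?_ ?_
  · refine hclose.trans (Finset.card_le_card fun m hm => ?_)
    rw [Finset.mem_filter] at hm ⊢
    exact ⟨hm.1, by rw [hm.2, neg_neg]⟩
  · intro h'
    exact hne (by rw [← neg_neg (ε m₁), h'])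
  · have : (∑ m ∈ range p, C (-ε m) * X ^ m) = -∑ m ∈ range p, C (ε m) * X ^ m := by
      rw [← Finset.sum_neg_distrib]
      refine Finset.sum_congr rfl fun m _ => ?_
      rw [map_neg, neg_mul]
    rw [this]
    exact (dvd_neg).mpr hdvd

end Extremiser


section Fewnomial

/-- **The lever's other half — char-`p` fewnomial bound (the line's `stub_charPFewnomial`, candidate proof for the lead;
cycle 2 landed its TIGHTNESS `stub_charPFewnomial_tight`).**  Over a field `K` of characteristic `p`, a non-zero `g` of
degree `< p` divisible by `(X-1)^m` has at least `m + 1` monomials.  Proof: by `sum_mul_pow_eq_zero_of_pow_dvd` the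
power moments `Σ_{e ∈ supp g} g_e·e^j` vanish for `j < m`; if `|supp g| ≤ m` this is a Vandermonde system in the
`|supp g|` distinct nodes `e mod p` (`e < p`), so all `g_e = 0` (`Matrix.det_vandermonde_ne_zero_iff`,
`Matrix.eq_zero_of_vecMul_eq_zero`) — absurd.  (= minimum distance `m+1` of the repeated-root cyclic code `⟨(x-1)^m⟩`,
Castagnoli–Massey–Schoeller–von Seemann 1991, Thm 1.) [folklore] -/
theorem charP_fewnomial (K : Type*) [Field K] (p : ℕ) [Fact p.Prime] [CharP K p] (g : K[X]) (m : ℕ)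
    (hg : g ≠ 0) (hdeg : g.natDegree < p) (hdvd : (X - C (1 : K)) ^ m ∣ g) : m + 1 ≤ g.support.card := by
  by_contra hlt
  rw [not_le] at hlt
  set S := g.support with hS
  -- `g` as a `range p` sum, and its moments
  have hsum : g = ∑ i ∈ range p, C (g.coeff i) * X ^ i := by
    conv_lhs => rw [as_sum_range' g p hdeg]
    simp only [C_mul_X_pow_eq_monomial]
  have hmom : ∀ j, j < S.card → ∑ i ∈ range p, g.coeff i * (i : K) ^ j = 0 := fun j hj =>
    sum_mul_pow_eq_zero_of_pow_dvd (fun i => g.coeff i) p m (hsum ▸ hdvd) j (by omega)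
  have hSp : ∀ e ∈ S, e < p := fun e he => lt_of_le_of_lt (le_natDegree_of_mem_supp e he) hdeg
  have hmomS : ∀ j, j < S.card → ∑ e ∈ S, g.coeff e * (e : K) ^ j = 0 := by
    intro j hj
    rw [← hmom j hj]
    refine Finset.sum_subset (fun e he => Finset.mem_range.mpr (hSp e he)) ?_
    intro e _ heS
    rw [hS, mem_support_iff, not_not] at heS
    rw [heS, zero_mul]
  -- Vandermonde in the nodes `e mod p`, `e ∈ S`
  set f : Fin S.card ≃ S := S.equivFin.symm with hf
  set nodes : Fin S.card → K := fun i => ((f i : ℕ) : K) with hnodes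
  set v : Fin S.card → K := fun i => g.coeff (f i : ℕ) with hv
  have hinj : Function.Injective nodes := by
    intro i j hij
    have hi : ((f i : ℕ)) < p := hSp _ (f i).2
    have hj' : ((f j : ℕ)) < p := hSp _ (f j).2
    have hmod : (f i : ℕ) ≡ (f j : ℕ) [MOD p] := (CharP.natCast_eq_natCast K p).mp hij
    have heq : (f i : ℕ) = (f j : ℕ) := hmod.eq_of_lt_of_lt hi hj'
    exact f.injective (Subtype.ext heq)
  have hdet : (Matrix.vandermonde nodes).det ≠ 0 := Matrix.det_vandermonde_ne_zero_iff.mpr hinj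
  have hvec : Matrix.vecMul v (Matrix.vandermonde nodes) = 0 := by
    funext j
    have hsumS : ∑ i : Fin S.card, v i * nodes i ^ (j : ℕ) = ∑ e ∈ S, g.coeff e * (e : K) ^ (j : ℕ) := by
      rw [← Finset.sum_coe_sort S (fun e => g.coeff e * (e : K) ^ (j : ℕ))]
      exact Fintype.sum_equiv f _ _ fun i => rfl
    simp only [Matrix.vecMul, dotProduct, Matrix.vandermonde_apply, Pi.zero_apply]
    rw [hsumS, hmomS j j.2]
  have hv0 : v = 0 := Matrix.eq_zero_of_vecMul_eq_zero hdet hvec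
  -- but every node carries a non-zero coefficient
  have hpos : 0 < S.card := Finset.card_pos.mpr (support_nonempty.mpr hg)
  have h0 := congr_fun hv0 ⟨0, hpos⟩
  simp only [hv, Pi.zero_apply] at h0
  have hmem : ((f ⟨0, hpos⟩ : ℕ)) ∈ g.support := (f ⟨0, hpos⟩).2
  exact (mem_support_iff.mp hmem) h0

end Fewnomial

section OrderDichotomy

variable (K : Type*) [Field K] (p : ℕ) [Fact p.Prime] [CharP K p]

/-- **The lever's bookkeeping — cyclic order dichotomy (the line's `stub_cyclicOrderDichotomy`, candidate proof for the
lead).**  Over a field `K` of characteristic `p`: if `A, B, F ≠ 0`, `deg F < p` and `X^p - 1 ∣ A·B - c·F`, then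
`ord₁ A + ord₁ B = ord₁ F` when `c ≠ 0`, and `ord₁ A + ord₁ B ≥ p` when `c = 0`.  (`X^p - 1 = (X-1)^p`; for `c ≠ 0`,
`ord₁ F < p` so `(X-1)^{ord₁ F}` divides `A·B = c·F + (X-1)^p·Q` and `(X-1)^{ord₁ F + 1}` does not.) [folklore] -/
theorem cyclic_order_dichotomy (A B F : K[X]) (c : K) (hA : A ≠ 0) (hB : B ≠ 0) (hF : F ≠ 0)
    (hdegF : F.natDegree < p) (hdvd : (X ^ p - 1 : K[X]) ∣ A * B - C c * F) :
    (c ≠ 0 → rootMultiplicity (1 : K) A + rootMultiplicity (1 : K) B = rootMultiplicity (1 : K) F) ∧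
    (c = 0 → p ≤ rootMultiplicity (1 : K) A + rootMultiplicity (1 : K) B) := by
  have hAB : A * B ≠ 0 := mul_ne_zero hA hB
  rw [← X_sub_C_one_pow_char K p] at hdvd
  obtain ⟨Q, hQ⟩ := hdvd
  have hABeq : A * B = C c * F + (X - C (1 : K)) ^ p * Q := by rw [← hQ]; ring
  rw [← rootMultiplicity_mul hAB]
  refine ⟨fun hc => ?_, fun hc => ?_⟩
  · set n := rootMultiplicity (1 : K) F with hn
    have hFn : (X - C (1 : K)) ^ n ∣ F := pow_rootMultiplicity_dvd F 1
    have hnp : n < p := by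
      have h1 := natDegree_le_of_dvd hFn hF
      rw [natDegree_pow, natDegree_X_sub_C, mul_one] at h1
      omega
    apply le_antisymm
    · rw [rootMultiplicity_le_iff hAB]
      intro h
      apply pow_rootMultiplicity_not_dvd hF (1 : K)
      rw [← hn]
      have h2 : (X - C (1 : K)) ^ (n + 1) ∣ A * B - (X - C (1 : K)) ^ p * Q :=
        dvd_sub h (dvd_mul_of_dvd_left (pow_dvd_pow _ (by omega)) _)
      rw [hABeq, add_sub_cancel_right, dvd_C_mul hc] at h2
      exact h2
    · rw [le_rootMultiplicity_iff hAB, hABeq]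
      exact dvd_add (dvd_mul_of_dvd_right hFn _) (dvd_mul_of_dvd_left (pow_dvd_pow _ hnp.le) _)
  · rw [le_rootMultiplicity_iff hAB, hABeq, hc, C_0, zero_mul, zero_add]
    exact dvd_mul_right _ _

end OrderDichotomy

section ExactOrder

variable (p : ℕ) [Fact p.Prime]

/-- `Σ_{m<p} X^m = (X-1)^{p-1}` in `𝔽_p[X]`. -/
theorem sum_X_pow_eq_X_sub_one_pow :
    (∑ m ∈ range p, (X : (ZMod p)[X]) ^ m) = (X - C 1) ^ (p - 1) := by
  have hprime : p.Prime := Fact.out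
  have h1 : (∑ m ∈ range p, (X : (ZMod p)[X]) ^ m) * (X - 1) = X ^ p - 1 := geom_sum_mul X p
  have h2 : (X - C (1 : ZMod p)) ^ p = X ^ p - 1 := by
    rw [sub_pow_char, ← C_pow, one_pow, C_1]
  have hp1 : p = p - 1 + 1 := by have := hprime.one_lt; omega
  have h3 : (∑ m ∈ range p, (X : (ZMod p)[X]) ^ m) * (X - C 1) = (X - C 1) ^ (p - 1) * (X - C 1) := by
    rw [← pow_succ, ← hp1, h2, C_1, h1]
  exact mul_right_cancel₀ (X_sub_C_ne_zero 1) h3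

/-- **The Legendre target ATTAINS the ceiling** (`≥` half of the line's `stub_feketeModPOrder`, over `𝔽_p`):
`(X-1)^{(p-1)/2} ∣ F̄_p`.  Proof: by Euler's criterion `F̄_p = Σ_{m<p} m^{(p-1)/2} X^m = (X·d/dX)^{(p-1)/2} Σ_{m<p} X^m
= (X·d/dX)^{(p-1)/2} (X-1)^{p-1}` in characteristic `p`, and each application of `X·d/dX` costs one factor `X - 1`
(`X_sub_C_pow_dvd_iterate`), leaving `(X-1)^{p-1-(p-1)/2} = (X-1)^{(p-1)/2}`. [folklore] -/
theorem half_pow_dvd_fekete_zmod (hp : p ≠ 2) :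
    (X - C (1 : ZMod p)) ^ ((p - 1) / 2) ∣ ∑ m ∈ range p, C ((legendreSym p m : ℤ) : ZMod p) * X ^ m := by
  have hprime : p.Prime := Fact.out
  obtain ⟨h, hh⟩ : ∃ h, p = 2 * h + 1 := hprime.eq_two_or_odd'.resolve_left hp |>.imp fun h hh => by omega
  have hhalf : (p - 1) / 2 = h := by omega
  have hdiv2 : p / 2 = h := by omega
  have hU : (X - C (1 : ZMod p)) ^ (p - 1) ∣ ∑ m ∈ range p, C ((fun _ : ℕ => (1 : ZMod p)) m) * X ^ m := by
    refine ⟨1, ?_⟩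
    rw [mul_one, ← sum_X_pow_eq_X_sub_one_pow p]
    refine Finset.sum_congr rfl fun m _ => ?_
    simp
  have hit := X_sub_C_pow_dvd_iterate _ (p - 1) hU h (by omega)
  have hiter := iterate_X_mul_derivative_sum_C_mul_X_pow (fun _ : ℕ => (1 : ZMod p)) p h
  rw [hiter, show p - 1 - h = h by omega] at hit
  have heq : (∑ m ∈ range p, C ((legendreSym p m : ℤ) : ZMod p) * X ^ m) =
      ∑ m ∈ range p, C ((fun _ : ℕ => (1 : ZMod p)) m * (m : ZMod p) ^ h) * X ^ m := by
    refine Finset.sum_congr rfl fun m _ => ?_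
    rw [legendreSym.eq_pow, hdiv2, Int.cast_natCast, one_mul]
  rw [hhalf, heq]
  exact hit

/-- Over any field `K` of characteristic `p` (`p` odd): `(X-1)^{(p-1)/2} ∣ F̄_p` (push along `𝔽_p → K`). -/
theorem half_pow_dvd_fekete (K : Type*) [Field K] [CharP K p] (hp : p ≠ 2) :
    (X - C (1 : K)) ^ ((p - 1) / 2) ∣ ∑ m ∈ range p, C ((legendreSym p m : ℤ) : K) * X ^ m := by
  have h := Polynomial.map_dvd (ZMod.castHom (dvd_refl p) K) (half_pow_dvd_fekete_zmod p hp)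
  rw [Polynomial.map_pow, Polynomial.map_sub, map_X, map_C, map_one] at h
  have heq : (∑ m ∈ range p, C ((legendreSym p m : ℤ) : ZMod p) * X ^ m).map (ZMod.castHom (dvd_refl p) K) =
      ∑ m ∈ range p, C ((legendreSym p m : ℤ) : K) * X ^ m := by
    rw [Polynomial.map_sum]
    refine Finset.sum_congr rfl fun m _ => ?_
    rw [Polynomial.map_mul, Polynomial.map_pow, map_X, map_C, map_intCast]
  rwa [heq] at h

/-- `((m|p) : K)² = 1` for `1 ≤ m < p`. -/
theorem legendreSym_cast_sq (K : Type*) [Field K] (m : ℕ) (h1 : 1 ≤ m) (h2 : m < p) :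
    (((legendreSym p m : ℤ) : K)) ^ 2 = 1 := by
  have hne : ((((m : ℕ) : ℤ)) : ZMod p) ≠ 0 := by
    rw [Int.cast_natCast, Ne, ZMod.natCast_eq_zero_iff]
    exact Nat.not_dvd_of_pos_of_lt (by omega) h2
  rcases legendreSym.eq_one_or_neg_one p hne with h | h <;> simp [h]

/-- **Exact order** — the ceiling of `rootMultiplicity_one_le_half_of_unimodular` is ATTAINED by the Legendre target:
`rootMultiplicity 1 F̄_p = (p-1)/2` over every field `K` of characteristic `p`, `p` odd.  (This is literally the line's
`stub_feketeModPOrder` — `fekete K p` unfolds to this sum — obtained here as the tightness statement of the ceiling;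
candidate proof for the lead.) -/
theorem rootMultiplicity_one_fekete_eq_half (K : Type*) [Field K] [CharP K p] (hp : p ≠ 2) :
    rootMultiplicity (1 : K) (∑ m ∈ Finset.range p, C ((legendreSym p m : ℤ) : K) * X ^ m) = (p - 1) / 2 := by
  refine le_antisymm (rootMultiplicity_one_fekete_le_half p) ?_
  have hne : (∑ m ∈ Finset.range p, C ((legendreSym p m : ℤ) : K) * X ^ m) ≠ 0 := by
    refine sum_C_mul_X_pow_ne_zero _ p ?_
    rw [sum_sq_eq_neg_one p _ (by simp [legendreSym.at_zero]) fun m h1 h2 => legendreSym_cast_sq p K m h1 h2]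
    exact neg_ne_zero.mpr one_ne_zero
  rw [le_rootMultiplicity_iff hne]
  exact half_pow_dvd_fekete p K hp

end ExactOrder



/-! ## §G3  The vehicle too: `stub_primitiveReduction` PROVED (cycle 3) — with §G the line has no open stub; the crux is a THEOREM
(candidate proof of the whole crux attached to the item as evidence `FeketeNoSparseSplit_CandidateProof.lean`, for the lead to land)

refuter-cdisprove-stmt-ValiantsHypothesis-3997-g3-0.  POSITIVE construction (not a refutation, not landed under
`Theorems/`): with `Negative/LeverCeiling.lean` (stubs 1–3: `charP_fewnomial`, `rootMultiplicity_one_fekete_eq_half`,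
`cyclic_order_dichotomy`) this closes all four stubs of `Lines/cyclic-valuation-dichotomy.lean`, whose composition
`feketeNoSparseCyclicSplit` / `FeketeNoSparseSplit_of` is already kernel-checked — i.e. the crux is a THEOREM; the
standing adversary's final report is a proof.  Construction exactly as the line card (triage-sharpened): a valuation
subring `V ⊂ ℂ` with `p ∈ 𝔪_V` (`exists_valuationSubring_natCast_mem_maximalIdeal`), primitive models
`A₁, B₁ ∈ V[X]` of `A, B` (`exists_model`: `A₁ = a·A`, reduction monic hence `≠ 0`, same support), division of
`A₁B₁` by the monic `X^p - 1` over `V` versus over `ℂ` (`map_modByMonic`) to see that the remainder is `λ·F_p` with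
`λ = ab ∈ V` (read off at the coefficient of `X¹`, `(1|p) = 1`), and reduction modulo `𝔪_V`.
-/

section Vehicle

open IsLocalRing Literature.RingTheory.Valuation

/-- `supp (a·f) = supp f` for `a ≠ 0` (no zero divisors). -/
theorem support_C_mul_of_ne_zero {R : Type*} [CommRing R] [NoZeroDivisors R] {a : R} (ha : a ≠ 0)
    (f : R[X]) : (C a * f).support = f.support := by
  ext n
  simp [mem_support_iff, coeff_C_mul, ha]

/-- Coefficients of the Fekete sum over any commutative ring. -/
theorem coeff_feketeSum {R : Type*} [CommRing R] (p : ℕ) [Fact p.Prime] (n : ℕ) :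
    (∑ m ∈ Finset.range p, C ((legendreSym p m : ℤ) : R) * X ^ m).coeff n =
      if n < p then ((legendreSym p n : ℤ) : R) else 0 := by
  simp only [finsetSum_coeff, coeff_C_mul_X_pow]
  rw [Finset.sum_ite_eq (Finset.range p) n]
  simp [Finset.mem_range]

/-- The Fekete sum pushed along a ring hom. -/
theorem map_feketeSum {R S : Type*} [CommRing R] [CommRing S] (f : R →+* S) (p : ℕ) [Fact p.Prime] :
    (∑ m ∈ Finset.range p, C ((legendreSym p m : ℤ) : R) * X ^ m).map f =
      ∑ m ∈ Finset.range p, C ((legendreSym p m : ℤ) : S) * X ^ m := by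
  rw [Polynomial.map_sum]
  refine Finset.sum_congr rfl fun m _ => ?_
  rw [Polynomial.map_mul, Polynomial.map_pow, map_X, map_C, map_intCast]

/-- `deg F_p ≤ p - 1`. -/
theorem natDegree_feketeSum_le {R : Type*} [CommRing R] (p : ℕ) [Fact p.Prime] :
    (∑ m ∈ Finset.range p, C ((legendreSym p m : ℤ) : R) * X ^ m).natDegree ≤ p - 1 := by
  refine natDegree_sum_le_of_forall_le _ _ fun i hi => ?_
  rw [Finset.mem_range] at hi
  exact (natDegree_C_mul_X_pow_le _ _).trans (by omega)

/-- **Candidate proof of `stub_primitiveReduction`** (statement verbatim, `fekete` unfolded). -/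
theorem primitiveReduction (p : ℕ) [Fact p.Prime] (A B : ℂ[X]) (hA : A ≠ 0) (hB : B ≠ 0)
    (hdvd : (X ^ p - 1 : ℂ[X]) ∣ A * B - ∑ m ∈ Finset.range p, C ((legendreSym p m : ℤ) : ℂ) * X ^ m) :
    ∃ (K : Type) (_ : Field K) (_ : CharP K p) (A' B' : K[X]) (c : K),
      A' ≠ 0 ∧ B' ≠ 0 ∧ A'.support ⊆ A.support ∧ B'.support ⊆ B.support ∧
      (X ^ p - 1 : K[X]) ∣ A' * B' - C c * ∑ m ∈ Finset.range p, C ((legendreSym p m : ℤ) : K) * X ^ m := by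
  have hprime : p.Prime := Fact.out
  -- a place of `ℂ` above `p`
  obtain ⟨V, hpV⟩ := exists_valuationSubring_natCast_mem_maximalIdeal (K := ℂ) hprime
  haveI hchar : CharP (ResidueField V) p := charP_residueField V hpV
  have hinj : Function.Injective (algebraMap V ℂ) := fun x y h => Subtype.ext h
  -- primitive models of `A` and `B`
  obtain ⟨a, ha, A₁, hA₁, hA₁red⟩ := exists_model V hA (IsAlgClosed.splits A)
  obtain ⟨b, hb, B₁, hB₁, hB₁red⟩ := exists_model V hB (IsAlgClosed.splits B)
  -- the Fekete sums
  set F : ℂ[X] := ∑ m ∈ Finset.range p, C ((legendreSym p m : ℤ) : ℂ) * X ^ m with hF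
  set FV : V[X] := ∑ m ∈ Finset.range p, C ((legendreSym p m : ℤ) : V) * X ^ m with hFV
  have hFVmap : FV.map (algebraMap V ℂ) = F := map_feketeSum _ p
  have hFVred : FV.map (residue V) = ∑ m ∈ Finset.range p, C ((legendreSym p m : ℤ) : ResidueField V) * X ^ m :=
    map_feketeSum _ p
  -- monic divisors
  have hmonicV : (X ^ p - 1 : V[X]).Monic := by
    simpa using monic_X_pow_sub_C (1 : V) hprime.ne_zero
  have hmonicC : (X ^ p - 1 : ℂ[X]).Monic := by
    simpa using monic_X_pow_sub_C (1 : ℂ) hprime.ne_zero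
  have hXmap : (X ^ p - 1 : V[X]).map (algebraMap V ℂ) = X ^ p - 1 := by
    rw [Polynomial.map_sub, Polynomial.map_pow, map_X, Polynomial.map_one]
  have hXred : (X ^ p - 1 : V[X]).map (residue V) = X ^ p - 1 := by
    rw [Polynomial.map_sub, Polynomial.map_pow, map_X, Polynomial.map_one]
  -- the product of the models and its division by `X^p - 1` over `V`
  set P : V[X] := A₁ * B₁ with hP
  set r : V[X] := P %ₘ (X ^ p - 1) with hr
  obtain ⟨Q, hQ⟩ := hdvd
  have hABQ : A * B = F + (X ^ p - 1) * Q := by rw [← hQ]; ring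
  have hPmap : P.map (algebraMap V ℂ) = C (a * b) * F + (X ^ p - 1) * (C (a * b) * Q) := by
    rw [hP, Polynomial.map_mul, hA₁, hB₁, map_mul]
    calc C a * A * (C b * B) = C a * C b * (A * B) := by ring
      _ = C a * C b * (F + (X ^ p - 1) * Q) := by rw [hABQ]
      _ = _ := by ring
  have hFdeg : (C (a * b) * F).degree < (X ^ p - 1 : ℂ[X]).degree := by
    rw [degree_C_mul (mul_ne_zero ha hb)]
    have h1 : (X ^ p - 1 : ℂ[X]).degree = p := by simpa using degree_X_pow_sub_C hprime.pos (1 : ℂ)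
    rw [h1]
    refine lt_of_le_of_lt (degree_le_of_natDegree_le (natDegree_feketeSum_le p)) ?_
    exact_mod_cast (show p - 1 < p by have := hprime.one_lt; omega)
  have hrmap : r.map (algebraMap V ℂ) = C (a * b) * F := by
    rw [hr, map_modByMonic _ hmonicV, hPmap, hXmap, add_modByMonic,
      (modByMonic_eq_zero_iff_dvd hmonicC).mpr (dvd_mul_right _ _), add_zero,
      (modByMonic_eq_self_iff hmonicC).mpr hFdeg]
  -- `λ = ab` lies in `V`: read it off at the coefficient of `X¹`
  have hcoef : ∀ n, algebraMap V ℂ (r.coeff n) = a * b * F.coeff n := by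
    intro n
    have h := congr_arg (fun q : ℂ[X] => q.coeff n) hrmap
    simp only [coeff_map, coeff_C_mul] at h
    exact h
  have hF1 : F.coeff 1 = 1 := by
    rw [hF, coeff_feketeSum, if_pos hprime.one_lt]
    simp [legendreSym.at_one]
  set lam : V := r.coeff 1 with hlam
  have hlamC : algebraMap V ℂ lam = a * b := by rw [hlam, hcoef 1, hF1, mul_one]
  have hreq : r = C lam * FV := by
    apply Polynomial.map_injective (algebraMap V ℂ) hinj
    rw [hrmap, Polynomial.map_mul, map_C, hFVmap]
    congr 2
    exact hlamC.symm
  have hPdecomp : P = C lam * FV + (X ^ p - 1) * (P /ₘ (X ^ p - 1)) := by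
    rw [← hreq, hr, modByMonic_add_div]
  -- the reduction
  refine ⟨ResidueField V, inferInstance, hchar, A₁.map (residue V), B₁.map (residue V), residue V lam,
    ?_, ?_, ?_, ?_, ?_⟩
  · rw [hA₁red]; exact (monic_redPoly V A).ne_zero
  · rw [hB₁red]; exact (monic_redPoly V B).ne_zero
  · refine (support_map_subset _ _).trans (le_of_eq ?_)
    rw [← support_C_mul_of_ne_zero ha A, ← hA₁, support_map_of_injective _ hinj]
  · refine (support_map_subset _ _).trans (le_of_eq ?_)
    rw [← support_C_mul_of_ne_zero hb B, ← hB₁, support_map_of_injective _ hinj]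
  · have hPsub : P - C lam * FV = (X ^ p - 1) * (P /ₘ (X ^ p - 1)) := sub_eq_iff_eq_add'.mpr hPdecomp
    refine ⟨(P /ₘ (X ^ p - 1)).map (residue V), ?_⟩
    have h := congr_arg (Polynomial.map (residue V)) hPsub
    rw [Polynomial.map_sub, Polynomial.map_mul, Polynomial.map_mul, Polynomial.map_mul, map_C, hFVred,
      hXred] at h
    exact h


end Vehicle

/-! ## §G4  The char-`p` shadow TRUTH (cycle 4): `(p+3)/2` is not the truth of the characteristic-`p` problem either,
and reduction at the place over `p` is LOSSY from `p = 17` on (kit jobs j014278, j014513)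

The line bounds `|supp A| + |supp B| ≥ |supp Ā| + |supp B̄| ≥ ord₁ Ā + ord₁ B̄ + 2 = (p+3)/2`.  Two inequalities, two losses.
EXHAUSTIVE char-`p` minima (PARI/GP, job j014278: all factorizations `Ā·B̄ = F̄_p` over `𝔽_p` and over `𝔽̄_p` — distribute
`x`, the `(p+1)/2` powers of `x - 1` and the linear factors of the Eulerian cofactor `G`, `F̄_p = ±x(x-1)^{(p-1)/2} G`, over
the splitting field `𝔽_{p^k}` of `G`; j014513: `p = 29, 31` by DP over root subsets), against the line's certificate and the
complex truth (cycle 1, exhaustive over all `2^{p-3}` complex splittings):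

  `p`            :  3  5  7  11  13  17  19  23  29  31
  `(p+3)/2`      :  3  4  5   7   8  10  11  13  16  17   (the lever = the line's certificate)
  `min over 𝔽_p` :  3  4  7   9  10  13  13  21  22  25
  `min over 𝔽̄_p`:  3  4  7   9  10  13  13  21  22  25   (`k` = 1,1,2,4,4,2,6,5,8,6; always attained `𝔽_p`-rationally)
  `min over ℂ`   :  3  4  7   9  10  14  15  23  22   ?   (cycle 1 / item evidence; `p = 31 ≡ 7 (8)` not run)

So (i) the SECOND inequality is far from tight: the char-`p` problem itself has minimum `≈ 0.7p–0.9p`, not `p/2` — the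
multiplicity-at-`1` lever ignores the cofactor `G` ("unramified", BarrierNotes-ideator2 §B1) completely, and a char-`p`
support theory for `(x-1)^i·(divisors of G)` is where the missing `≈ p/2 - Θ(√p)` lives; (ii) the FIRST inequality is lossy
too: from `p = 17` on the char-`p` minimum can be BELOW the complex one (`13 < 14`, `13 < 15`, `21 < 23`; equal again at `p = 29`), witnessed over
`𝔽_17` itself by `fekete_seventeen_charP_split`: `F̄_17 = (1 + 3X - 4X² - 4X⁵ + 3X⁶ + X⁷)·(X - 2X² - 8X³ + X⁵ - 8X⁷ - 2X⁸ + X⁹)`,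
support-sum `6 + 7 = 13` (both factors palindromic; over `ℤ` the product is `F_17 + 17·(-X³ - X⁴ + 2X⁵ + 2X¹² - X¹³ - X¹⁴)` —
a near-splitting of `F_17` with a `17`-divisible defect on six coefficients), whereas every complex splitting of `F_17` has
support-sum `≥ 14`.  Neither loss threatens the crux (`p^{1/2+δ} ≪ (p+3)/2`); both bound what THIS line can ever certify.
-/

section CharPShadow

/-- `F₁₇` reduced modulo `17`, explicitly (quadratic residues mod 17: `1, 2, 4, 8, 9, 13, 15, 16`). -/
theorem fekete_seventeen_mod_seventeen_eq :
    (∑ m ∈ Finset.range 17, C ((legendreSym 17 m : ℤ) : ZMod 17) * X ^ m) =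
      X + X ^ 2 - X ^ 3 + X ^ 4 - X ^ 5 - X ^ 6 - X ^ 7 + X ^ 8 + X ^ 9 - X ^ 10 - X ^ 11 - X ^ 12 + X ^ 13
        - X ^ 14 + X ^ 15 + X ^ 16 := by
  simp [Finset.sum_range_succ]
  norm_num
  ring

/-- The 6-term factor `1 + 3X - 4X² - 4X⁵ + 3X⁶ + X⁷` in injective-exponent form. -/
theorem A17_eq_sum : (1 + 3 * X - 4 * X ^ 2 - 4 * X ^ 5 + 3 * X ^ 6 + X ^ 7 : (ZMod 17)[X]) =
    ∑ i : Fin 6, C ((![1, 3, -4, -4, 3, 1] : Fin 6 → ZMod 17) i) * X ^ ((![0, 1, 2, 5, 6, 7] : Fin 6 → ℕ) i) := by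
  simp [Fin.sum_univ_succ, C_ofNat]
  ring

/-- `1 + 3X - 4X² - 4X⁵ + 3X⁶ + X⁷` has exactly six monomials over `𝔽₁₇`. -/
theorem card_support_A17 :
    ((1 + 3 * X - 4 * X ^ 2 - 4 * X ^ 5 + 3 * X ^ 6 + X ^ 7 : (ZMod 17)[X])).support.card = 6 := by
  rw [A17_eq_sum]
  apply card_support_eq'
  · decide
  · intro i; fin_cases i <;> decide

/-- The 7-term factor `X - 2X² - 8X³ + X⁵ - 8X⁷ - 2X⁸ + X⁹` in injective-exponent form. -/
theorem B17_eq_sum : (X - 2 * X ^ 2 - 8 * X ^ 3 + X ^ 5 - 8 * X ^ 7 - 2 * X ^ 8 + X ^ 9 : (ZMod 17)[X]) =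
    ∑ i : Fin 7, C ((![1, -2, -8, 1, -8, -2, 1] : Fin 7 → ZMod 17) i) *
      X ^ ((![1, 2, 3, 5, 7, 8, 9] : Fin 7 → ℕ) i) := by
  simp [Fin.sum_univ_succ, C_ofNat]
  ring

/-- `X - 2X² - 8X³ + X⁵ - 8X⁷ - 2X⁸ + X⁹` has exactly seven monomials over `𝔽₁₇`. -/
theorem card_support_B17 :
    ((X - 2 * X ^ 2 - 8 * X ^ 3 + X ^ 5 - 8 * X ^ 7 - 2 * X ^ 8 + X ^ 9 : (ZMod 17)[X])).support.card = 7 := by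
  rw [B17_eq_sum]
  apply card_support_eq'
  · decide
  · intro i; fin_cases i <;> decide

/-- **The char-`17` shadow beats the complex truth**: `F̄_17 = (1 + 3X - 4X² - 4X⁵ + 3X⁶ + X⁷)·(X - 2X² - 8X³ + X⁵ - 8X⁷ - 2X⁸ + X⁹)`
in `𝔽_17[X]`, support-sum `13` — below the minimum `14` over ALL complex splittings of `F_17` (exhaustive, cycle 1), above the
line's certificate `(17+3)/2 = 10`; `13` is the exact char-`17` minimum (j014278).  [computation: kit j014278] -/
theorem fekete_seventeen_charP_split : ∃ A B : (ZMod 17)[X],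
    A * B = ∑ m ∈ Finset.range 17, C ((legendreSym 17 m : ℤ) : ZMod 17) * X ^ m ∧
    A.support.card + B.support.card = 13 := by
  refine ⟨1 + 3 * X - 4 * X ^ 2 - 4 * X ^ 5 + 3 * X ^ 6 + X ^ 7,
    X - 2 * X ^ 2 - 8 * X ^ 3 + X ^ 5 - 8 * X ^ 7 - 2 * X ^ 8 + X ^ 9, ?_, ?_⟩
  · rw [fekete_seventeen_mod_seventeen_eq]
    have h17 : (17 : (ZMod 17)[X]) = 0 := by exact_mod_cast CharP.cast_eq_zero (ZMod 17)[X] 17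
    have key : (1 + 3 * X - 4 * X ^ 2 - 4 * X ^ 5 + 3 * X ^ 6 + X ^ 7 : (ZMod 17)[X]) *
        (X - 2 * X ^ 2 - 8 * X ^ 3 + X ^ 5 - 8 * X ^ 7 - 2 * X ^ 8 + X ^ 9) =
        (X + X ^ 2 - X ^ 3 + X ^ 4 - X ^ 5 - X ^ 6 - X ^ 7 + X ^ 8 + X ^ 9 - X ^ 10 - X ^ 11 - X ^ 12 + X ^ 13
          - X ^ 14 + X ^ 15 + X ^ 16)
        + 17 * (-X ^ 3 - X ^ 4 + 2 * X ^ 5 + 2 * X ^ 12 - X ^ 13 - X ^ 14) := by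
      ring
    rw [key, h17, zero_mul, add_zero]
  · rw [card_support_A17, card_support_B17]

end CharPShadow

/-! ## §E  Near-misses: none (see the module docstring). -/

end Summit.ValiantsHypothesis.ValiantsHypothesis.Cruxes.FeketeNoSparseSplit.Disproof
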